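import Summits.QuantumFields.YangMills.Theorems.BalabanLadderIRcofEquipartitionSeamSliceKernelSeamTransport
import Summits.QuantumFields.YangMills.Theorems.BalabanLadderIRcofEquipartitionSeamSpectralDict
import Summits.QuantumFields.YangMills.Theorems.BalabanLadderIRcofEquipartitionSeamSpectralDictRealPosType
import Summits.QuantumFields.YangMills.Theorems.BalabanLadderIRcofEquipartitionSeamSpectralDictKernelCalc
import Literature.Analysis.OperatorTheory.HeterogeneousCyclicPeeling
import HarnessLib

/-!
# Balaban ladder ∕ IRcof ∕ LINE «equipartition_seam» — THE LOCATED STUB L PROVED: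
# `sliceRealisationV_holds : SpectralDict.SliceRealisationV` (sorry-free)

HONEST LABEL.  The Yang–Mills mass gap (Clay) is NOT proved here or anywhere in this line; crux IRcof
(stmt-QuantumFields-26930) and IR (stmt-QuantumFields-19354) stand 0∕1; row 47 «equipartition_seam» is a PLAN WITH
PROOFS of its bookkeeping part (mechanism 0, width 0); nothing continuum ∕ OS ∕ Clay-level is touched.  What this file
closes is ONE registered stub of the skeleton `Cruxes/IRcof/Lines/equipartition_seam.lean` (rev 9): the located stub
`stub_sliceRealisationV : SpectralDict.SliceRealisationV` (the time-slice ∕ transfer-operator REALISATION of the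
split-weight sector functions `secZ`, `secW` — pure finite-dimensional Fubini∕Haar bookkeeping on the periodic box
`(2S+1)⁴`, no estimate of constructive QFT).  After it lands (LEAD, helper Theorems files) the skeleton goes to rev 10
with stubs 6 → 5 (`S1, S3ʷ, T, N, S5ᵛ` open) and `spectralDictV_holds` proved outright from landed theorems.

WHAT IS PROVED.  `SpectralDict.SliceRealisationV` (landed verbatim, p696729,
`Theorems/BalabanLadderIRcofEquipartitionSeamSpectralDict.lean` l.57) asks, for every central isogeny `π : H → G` of
compact simple Lie groups with finite non-trivial kernel, every split weight `w` (`TwistSplitWeight`), box `S` and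
sector `z₀`, for a probability space `(X, μ)`, a bounded symmetric strongly measurable positive-type kernel `K`, a
measure-preserving action `T` of `(ker π)³` fixing `K`, such that (Z) every twisted partition function
`secZ π w (withEl z₀ e) S (M+2)` is the `T e`-twisted cyclic trace of `K^{M+2}`, and (W) for every species `A` of
temporal thickness `thick A` with `4·thick A ≤ 2S+1` a block kernel `Bk` with `|Bk| ≤ nrm A · pathK μ K (thick A − 1)`
such that `secW π w (withEl z₀ e) S A` is the cyclic `K`-chain of length `M+3` with ONE bond replaced by the insertion
`∫∫ K(V₀,u) Bk(u,v) K(T e v, V₁)`.  WITNESSES (theorem `sliceRealisationV_holds`, PART 4): `X :=` the spatial links of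
one time slice (`FinSpatialSite (2S+1)³ × Fin 3 → H`), `μ := ⊗ Haar`, `K := sandKernel Prod.fst shift w √magW` (the
gauge-averaged slice kernel of LEAD's F2a `…SliceKernelPackage`, sandwiched by the square root of the magnetic slice
weight `magW`, F4 `…SliceKernelSeam`), `T e := ctwist (elTwist π e⁻¹)`, `C` and the eleven (Z)-side clauses from
`zPackage_of_twistSplitWeight` (F5 `…SliceKernelZPackage`) with the real → complex positive-type bridge
`SpectralDict.complexPosType_of_real` (p699935); `thick A :=` number of consecutive time slices spanned by the support
of `A` (`tLo … tHi`), `nrm A :=` a nonnegative sup bound of `A.F`, `β_D := 0`, `S_D := 0`; (W): `rB := thick A − 1`,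
`Bk := blockKernel … M r (speciesL5 π A σ)` — the species read in the BLOCK LAYOUT `Fin ((M+3)+(r+2))` through the
cyclic relabelling `σ = relabel h (rotAmt (2S+1) (tLo A) M)` of the time axis which puts the block onto the support
window — with `norm_blockKernel_le`, `abs_blockKernel_le_pathK` and the identity `secW_withEl_eq_blockChain_of`.

THE PROOF OF (W) (PARTS 1–3 abstract over `(src, tgt, w, a)`, PART 4 the application).  (a) LEAD's F6∕F7
`secW_withEl_eq_integral_layers_seamAt` writes `secW` as the joint slice∕layer integral of
`Ã · ∏ₜ magW(Vₜ) · ∏ₜ tempKernel(Vₜ, Eₜ, seamₜ • V_{t+1})` with the whole twist parked as ONE seam `elTwist π e` on any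
chosen layer `t₁`; we choose the layer after the block and relabel the time axis along `σ` (`integral_comp_relabel` =
`measurePreserving_piCongrLeft` on both factors; `relabel_finRotate`: `σ` commutes with the cyclic shift).  (b) Stage A
`integral_layers_fixedSlices`: at fixed slices the layers outside the block integrate to the bond kernels `avgKernel`
(`integral_prod_tempKernel_pi`), the block's `r+1` layers stay inside `core`.  (c) Stage B: Fubini + the named splitting
`finSplit` of the slices into (outer `Fin (M+3)`, block `Fin (r+2)`); Stage C `block_inner`: the block, integrated over
its `r` inner slices with the weights `a(x)²`, IS the one-bond insertion `∫ K(p,u) Bk(u,v) K(z⁻¹ • v, q)` (`a` central-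
twist invariant, `integral_pi_succ_eq_integral_cons ∕ _snoc`).  (d) Stage D: the outer cycle is re-indexed by
`(finRotate (M+3)).symm` (`integral_pi_comp_perm`) to L's literal chain `K(V₀,u) … K(T e v, V₁) · ∏ₜ K(V_{t+1}, V_{t+2})`.
The window hypothesis of the species (`speciesL5_dep`, `window_relabel`: every support edge has its `zCoord`-time among
the block layers — `ZMod` arithmetic `relabel_natAdd_eq`) is what makes `Ã` a function of the block data only, and
`|Bk| ≤ nrm A · pathK` (`abs_blockKernel_le_pathK`) is `|Ã| ≤ nrm A` + `tempKernel ≥ 0` + Fubini back to the path kernel.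

CONTENTS ∕ LANDING PLAN (LEAD: four helper Theorems files `…SliceKernelBlock{Kernel,Core,Chain}.lean` +
`…SliceRealisation.lean`, each ≤ 400 lines, cut at the PART banners; each PART opens its own `section` with its full
`variable` context, so a cut needs only this header's imports∕opens — PART k imports PART k−1; heavy declarations are
pre-budgeted with `set_option maxHeartbeats … in`):
* PART 1 — index bookkeeping on `Fin ((M+3)+(r+2))`, padding, the named splitting `finSplit`, `blockKernel` +
  `stronglyMeasurable_uncurry_blockKernel`, `norm_blockKernel_le`, `abs_blockKernel_le_pathK`.
* PART 2 — peeling lemmas, Stage A `integral_layers_fixedSlices`, the block's layer integral `core`, measurability and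
  inequality helpers.
* PART 3 — Stage C `blockKernel_eq_integral_core`, `block_inner`; Stages B+D `integral_layers_eq_blockChain`.
* PART 4 — the relabelling `relabel` (`integral_comp_relabel`, `relabel_finRotate`, `rotAmt`, `relabel_natAdd_eq`), the
  temporal window and size of a species (`tLo, tHi, thick, nrm`), the species in the block layout (`speciesL5`,
  `speciesL5_dep`, `window_relabel`), `secW_withEl_eq_blockChain_of`, and `sliceRealisationV_holds`.

Farm: `lean check` rc 0, 0 errors, 0 `sorry`, 0 warnings (planner-ym-ir-idea-22 g8, 2026-08-29).
-/

noncomputable section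

open MeasureTheory ProbabilityTheory Finset Filter Function
open scoped BigOperators

namespace Summit.QuantumFields.YangMills.Cruxes.IRcof.EquipartitionSeam.SliceKernel

open Literature.MathematicalPhysics.QuantumFieldTheory (haarProbability)
open Literature.Analysis.OperatorTheory (measurePreserving_finSplit finSplit_apply_fst finSplit_apply_snd
  integral_pi_comp_perm)
open Summit.QuantumFields.YangMills.Cruxes.IRcof.EquipartitionSeam.SpectralDict (pathK)

/-! ## PART 1 — the block kernel of a windowed species -/

/-! ### Index bookkeeping on `Fin ((M + 3) + (r + 2))` -/

section Index

theorem val_finRotate {m : ℕ} (t : Fin m) : ((finRotate m t : Fin m) : ℕ) = ((t : ℕ) + 1) % m := by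
  cases m with
  | zero => exact t.elim0
  | succ n =>
    rw [finRotate_apply, Fin.val_add, Fin.val_one', Nat.add_mod_mod]

variable (M r : ℕ)

theorem finRotate_castAdd_castSucc (j : Fin (M + 2)) :
    finRotate ((M + 3) + (r + 2)) (Fin.castAdd (r + 2) (Fin.castSucc j)) = Fin.castAdd (r + 2) j.succ := by
  apply Fin.ext
  rw [val_finRotate]
  simp only [Fin.val_castAdd, Fin.val_castSucc, Fin.val_succ]
  exact Nat.mod_eq_of_lt (by omega)

theorem finRotate_castAdd_last :
    finRotate ((M + 3) + (r + 2)) (Fin.castAdd (r + 2) (Fin.last (M + 2))) = Fin.natAdd (M + 3) 0 := by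
  apply Fin.ext
  rw [val_finRotate]
  simp only [Fin.val_castAdd, Fin.val_last, Fin.val_natAdd, Fin.val_zero, add_zero]
  exact Nat.mod_eq_of_lt (by omega)

theorem finRotate_natAdd_castSucc (b : Fin (r + 1)) :
    finRotate ((M + 3) + (r + 2)) (Fin.natAdd (M + 3) (Fin.castSucc b)) = Fin.natAdd (M + 3) b.succ := by
  apply Fin.ext
  rw [val_finRotate]
  simp only [Fin.val_natAdd, Fin.val_castSucc, Fin.val_succ]
  rw [Nat.mod_eq_of_lt (by omega)]
  omega

theorem finRotate_natAdd_last :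
    finRotate ((M + 3) + (r + 2)) (Fin.natAdd (M + 3) (Fin.last (r + 1))) = Fin.castAdd (r + 2) 0 := by
  apply Fin.ext
  rw [val_finRotate]
  simp only [Fin.val_natAdd, Fin.val_last, Fin.val_castAdd, Fin.val_zero]
  rw [show M + 3 + (r + 1) + 1 = (M + 3) + (r + 2) by omega, Nat.mod_self]

theorem castAdd_ne_natAdd_last (j : Fin (M + 3)) :
    Fin.castAdd (r + 2) j ≠ Fin.natAdd (M + 3) (Fin.last (r + 1)) := by
  intro h
  have := congrArg Fin.val h
  simp only [Fin.val_castAdd, Fin.val_natAdd, Fin.val_last] at this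
  omega

theorem natAdd_castSucc_ne_natAdd_last (b : Fin (r + 1)) :
    Fin.natAdd (M + 3) (Fin.castSucc b) ≠ Fin.natAdd (M + 3) (Fin.last (r + 1)) := by
  intro h
  have := congrArg Fin.val h
  simp only [Fin.val_natAdd, Fin.val_castSucc, Fin.val_last] at this
  omega

/-- `Fin.cons (W 0) (Fin.snoc (middle of W) (W last)) = W`. -/
theorem cons_snoc_eta {α : Type*} (W : Fin (r + 2) → α) :
    (Fin.cons (W 0) (Fin.snoc (fun k : Fin r => W k.castSucc.succ) (W (Fin.last (r + 1)))) : Fin (r + 2) → α) = W := by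
  funext i
  refine Fin.cases ?_ (fun k => ?_) i
  · simp only [Fin.cons_zero]
  · simp only [Fin.cons_succ]
    refine Fin.lastCases ?_ (fun k' => ?_) k
    · simp only [Fin.snoc_last, Fin.succ_last]
    · simp only [Fin.snoc_castSucc]

/-- `x(last) · x(0) · ∏ⱼ x(j.castSucc) x(j.succ) = ∏ⱼ x(j)²` on `Fin (n + 2)`. -/
theorem prod_castSucc_mul_succ_eq_prod_sq (n : ℕ) (x : Fin (n + 2) → ℝ) :
    x (Fin.last (n + 1)) * x 0 * ∏ j : Fin (n + 1), (x j.castSucc * x j.succ) = ∏ j, x j ^ 2 := by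
  rw [Finset.prod_mul_distrib]
  have h1 : ∏ j : Fin (n + 2), x j = (∏ j : Fin (n + 1), x j.castSucc) * x (Fin.last (n + 1)) :=
    Fin.prod_univ_castSucc x
  have h2 : ∏ j : Fin (n + 2), x j = x 0 * ∏ j : Fin (n + 1), x j.succ := Fin.prod_univ_succ x
  have h3 : ∏ j : Fin (n + 2), x j ^ 2 = (∏ j : Fin (n + 2), x j) * ∏ j : Fin (n + 2), x j := by
    rw [← Finset.prod_mul_distrib]; exact Finset.prod_congr rfl fun j _ => sq (x j)
  rw [h3, congrArg₂ (· * ·) h1 h2]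
  ring

/-- `a(W 0)² a(W last)² ∏ₖ a(middle_k)² = ∏ᵢ a(W i)²` on `Fin (r + 2)`. -/
theorem sq_mul_sq_mul_prod_eq {α : Type*} (f : α → ℝ) (W : Fin (r + 2) → α) :
    f (W 0) * f (W (Fin.last (r + 1))) * ∏ k : Fin r, f (W k.castSucc.succ) = ∏ i, f (W i) := by
  rw [Fin.prod_univ_succ, Fin.prod_univ_castSucc]
  simp only [Fin.succ_last]
  ring

end Index

/-! ### Padding block data to full slice ∕ layer configurations -/

section Pad

variable {P Λ H : Type*} [One H] (M : ℕ) {r : ℕ}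

/-- Block slices `Vb : Fin (r+2) → Λ → H` padded by trivial outer slices. -/
def padV (Vb : Fin (r + 2) → Λ → H) : Fin ((M + 3) + (r + 2)) → Λ → H :=
  Fin.append (fun _ => 1) Vb

/-- Block layers `Eb : Fin (r+1) → P → H` padded by trivial layers (outer layers and the seam layer). -/
def padE (Eb : Fin (r + 1) → P → H) : Fin ((M + 3) + (r + 2)) → P → H :=
  Fin.append (fun _ => 1) (Fin.snoc Eb 1 : Fin (r + 2) → P → H)

@[simp] theorem padV_natAdd (Vb : Fin (r + 2) → Λ → H) (i : Fin (r + 2)) :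
    padV M Vb (Fin.natAdd (M + 3) i) = Vb i := by
  simp [padV]

@[simp] theorem padE_natAdd_castSucc (Eb : Fin (r + 1) → P → H) (b : Fin (r + 1)) :
    padE (P := P) M Eb (Fin.natAdd (M + 3) (Fin.castSucc b)) = Eb b := by
  simp [padE]

variable [MeasurableSpace H]

theorem measurable_padV :
    Measurable (padV (Λ := Λ) (H := H) M : (Fin (r + 2) → Λ → H) → _) := by
  refine measurable_pi_iff.2 fun t => ?_
  refine Fin.addCases (fun j => ?_) (fun i => ?_) t
  · simp only [padV, Fin.append_left]; exact measurable_const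
  · simp only [padV, Fin.append_right]; exact measurable_pi_apply i

theorem measurable_padE :
    Measurable (padE (P := P) (H := H) M : (Fin (r + 1) → P → H) → _) := by
  refine measurable_pi_iff.2 fun t => ?_
  refine Fin.addCases (fun j => ?_) (fun i => ?_) t
  · simp only [padE, Fin.append_left]; exact measurable_const
  · simp only [padE, Fin.append_right]
    refine Fin.lastCases ?_ (fun b => ?_) i
    · simp only [Fin.snoc_last]; exact measurable_const
    · simp only [Fin.snoc_castSucc]; exact measurable_pi_apply b

end Pad


/-! ### The splitting `Fin (n + r) → Y ≃ (Fin n → Y) × (Fin r → Y)` (the tree's, named) -/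

section Split

/-- The measurable splitting of a configuration on `Fin (n + r)` into its first `n` and last `r` coordinates
(`Literature.Analysis.OperatorTheory.measurePreserving_finSplit`, named). -/
def finSplit (Y : Type*) [MeasurableSpace Y] (n r : ℕ) : (Fin (n + r) → Y) ≃ᵐ (Fin n → Y) × (Fin r → Y) :=
  (MeasurableEquiv.piCongrLeft (fun _ : Fin (n + r) => Y) finSumFinEquiv).symm.trans
    (MeasurableEquiv.sumPiEquivProdPi fun _ : Fin n ⊕ Fin r => Y)

theorem measurePreserving_finSplit' {Y : Type*} [MeasurableSpace Y] (ρ : Measure Y) [IsFiniteMeasure ρ]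
    (n r : ℕ) : MeasurePreserving (finSplit Y n r) (Measure.pi fun _ => ρ)
      ((Measure.pi fun _ : Fin n => ρ).prod (Measure.pi fun _ : Fin r => ρ)) :=
  measurePreserving_finSplit n r

theorem finSplit_fst {Y : Type*} [MeasurableSpace Y] (n r : ℕ) (V : Fin (n + r) → Y) :
    (finSplit Y n r V).1 = fun t => V (Fin.castAdd r t) := rfl

theorem finSplit_snd {Y : Type*} [MeasurableSpace Y] (n r : ℕ) (V : Fin (n + r) → Y) :
    (finSplit Y n r V).2 = fun j => V (Fin.natAdd n j) := rfl

end Split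

/-! ### The block kernel of a windowed species and the block contraction -/

section Block

variable {P Λ H : Type*} [Fintype P] [Fintype Λ] [Group H] [TopologicalSpace H] [IsTopologicalGroup H]
  [CompactSpace H] [MeasurableSpace H] [BorelSpace H] (src tgt : Λ → P) (w : H → ℝ) (a : (Λ → H) → ℝ)

/-- **The block kernel** `Bk(u, v)` of a species factor `F` living in the block of `r + 2` consecutive slices
`u, x₁, …, x_r, v` (and the `r + 1` temporal layers between them): `a u · (∫ F · slab weight d(x, layers)) · a v`. -/
def blockKernel (M r : ℕ)
    (F : (Fin ((M + 3) + (r + 2)) → Λ → H) × (Fin ((M + 3) + (r + 2)) → P → H) → ℝ) (u v : Λ → H) : ℝ :=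
  a u * (∫ q : (Fin r → Λ → H) × (Fin (r + 1) → P → H),
      F (padV M (Fin.cons u (Fin.snoc q.1 v)), padE M q.2) *
        ((∏ i, a (q.1 i) ^ 2) * ∏ b : Fin (r + 1), tempKernel src tgt w
          ((Fin.cons u (Fin.snoc q.1 v) : Fin (r + 2) → Λ → H) (Fin.castSucc b)) (q.2 b)
          ((Fin.cons u (Fin.snoc q.1 v) : Fin (r + 2) → Λ → H) (Fin.succ b)))
    ∂((Measure.pi fun _ => Measure.pi fun _ : Λ => haarProbability H).prod
        (Measure.pi fun _ => Measure.pi fun _ : P => haarProbability H))) * a v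

omit [Fintype P] [Fintype Λ] [Group H] [TopologicalSpace H] [IsTopologicalGroup H] [CompactSpace H]
  [BorelSpace H] in
/-- Joint measurability of the chain `(u, v, x) ↦ u ∷ x :: v`. -/
theorem measurable_consSnoc (r : ℕ) :
    Measurable fun p : ((Λ → H) × (Λ → H)) × (Fin r → Λ → H) =>
      (Fin.cons p.1.1 (Fin.snoc p.2 p.1.2) : Fin (r + 2) → Λ → H) := by
  refine measurable_pi_iff.mpr fun j => ?_
  refine Fin.cases ?_ (fun k => ?_) j
  · simp only [Fin.cons_zero]; exact measurable_fst.comp measurable_fst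
  · simp only [Fin.cons_succ]
    refine Fin.lastCases ?_ (fun i => ?_) k
    · simp only [Fin.snoc_last]; exact measurable_snd.comp measurable_fst
    · simp only [Fin.snoc_castSucc]; exact (measurable_pi_apply i).comp measurable_snd

variable [SecondCountableTopology H]

omit [CompactSpace H] in
set_option maxHeartbeats 400000 in
/-- The slab weight `(∏ᵢ a(xᵢ)²) · ∏_b tempKernel (chain b) (layer b) (chain (b+1))` is jointly measurable in
`((u, v), (x, layers))`. -/
theorem measurable_slabWeight (hw : Continuous w) (ha : Measurable a) (r : ℕ) :
    Measurable fun p : ((Λ → H) × (Λ → H)) × ((Fin r → Λ → H) × (Fin (r + 1) → P → H)) =>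
      (∏ i, a (p.2.1 i) ^ 2) * ∏ b : Fin (r + 1), tempKernel src tgt w
        ((Fin.cons p.1.1 (Fin.snoc p.2.1 p.1.2) : Fin (r + 2) → Λ → H) (Fin.castSucc b)) (p.2.2 b)
        ((Fin.cons p.1.1 (Fin.snoc p.2.1 p.1.2) : Fin (r + 2) → Λ → H) (Fin.succ b)) := by
  have hch : Measurable fun p : ((Λ → H) × (Λ → H)) × ((Fin r → Λ → H) × (Fin (r + 1) → P → H)) =>
      (Fin.cons p.1.1 (Fin.snoc p.2.1 p.1.2) : Fin (r + 2) → Λ → H) :=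
    (measurable_consSnoc r).comp (measurable_fst.prodMk (measurable_fst.comp measurable_snd))
  have hchj : ∀ j : Fin (r + 2),
      Measurable fun p : ((Λ → H) × (Λ → H)) × ((Fin r → Λ → H) × (Fin (r + 1) → P → H)) =>
        (Fin.cons p.1.1 (Fin.snoc p.2.1 p.1.2) : Fin (r + 2) → Λ → H) j := fun j => (measurable_pi_apply j).comp hch
  have hq1 : ∀ i : Fin r,
      Measurable fun p : ((Λ → H) × (Λ → H)) × ((Fin r → Λ → H) × (Fin (r + 1) → P → H)) => p.2.1 i :=
    fun i => (measurable_pi_apply i).comp (measurable_fst.comp measurable_snd)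
  have hq2 : ∀ b : Fin (r + 1),
      Measurable fun p : ((Λ → H) × (Λ → H)) × ((Fin r → Λ → H) × (Fin (r + 1) → P → H)) => p.2.2 b :=
    fun b => (measurable_pi_apply b).comp (measurable_snd.comp measurable_snd)
  exact (Finset.measurable_prod _ fun i _ => (ha.comp (hq1 i)).pow_const 2).mul
    (Finset.measurable_prod _ fun b _ => (continuous_tempKernel src tgt w hw).measurable.comp
      ((hchj (Fin.castSucc b)).prodMk ((hq2 b).prodMk (hchj (Fin.succ b)))))

omit [Fintype P] [TopologicalSpace H] [IsTopologicalGroup H] [CompactSpace H] [MeasurableSpace H] [BorelSpace H]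
  [SecondCountableTopology H] in
theorem slabWeight_nonneg (hw0 : ∀ h, 0 ≤ w h) {r : ℕ}
    (p : ((Λ → H) × (Λ → H)) × ((Fin r → Λ → H) × (Fin (r + 1) → P → H))) :
    0 ≤ (∏ i, a (p.2.1 i) ^ 2) * ∏ b : Fin (r + 1), tempKernel src tgt w
        ((Fin.cons p.1.1 (Fin.snoc p.2.1 p.1.2) : Fin (r + 2) → Λ → H) (Fin.castSucc b)) (p.2.2 b)
        ((Fin.cons p.1.1 (Fin.snoc p.2.1 p.1.2) : Fin (r + 2) → Λ → H) (Fin.succ b)) :=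
  mul_nonneg (Finset.prod_nonneg fun _ _ => sq_nonneg _)
    (Finset.prod_nonneg fun _ _ => tempKernel_nonneg src tgt w hw0 _ _ _)

omit [Fintype P] [TopologicalSpace H] [IsTopologicalGroup H] [CompactSpace H] [MeasurableSpace H] [BorelSpace H]
  [SecondCountableTopology H] in
theorem slabWeight_le (hw0 : ∀ h, 0 ≤ w h) {Cw : ℝ} (hwC : ∀ h, w h ≤ Cw) {Ca : ℝ} (haC : ∀ V, |a V| ≤ Ca)
    {r : ℕ} (p : ((Λ → H) × (Λ → H)) × ((Fin r → Λ → H) × (Fin (r + 1) → P → H))) :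
    (∏ i, a (p.2.1 i) ^ 2) * ∏ b : Fin (r + 1), tempKernel src tgt w
        ((Fin.cons p.1.1 (Fin.snoc p.2.1 p.1.2) : Fin (r + 2) → Λ → H) (Fin.castSucc b)) (p.2.2 b)
        ((Fin.cons p.1.1 (Fin.snoc p.2.1 p.1.2) : Fin (r + 2) → Λ → H) (Fin.succ b)) ≤
      (Ca ^ 2) ^ r * (Cw ^ Fintype.card Λ) ^ (r + 1) := by
  have hCw : 0 ≤ Cw ^ Fintype.card Λ :=
    (tempKernel_nonneg src tgt w hw0 1 1 1).trans (tempKernel_le_pow src tgt w hw0 hwC 1 1 1)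
  refine mul_le_mul ?_ ?_ (Finset.prod_nonneg fun _ _ => tempKernel_nonneg src tgt w hw0 _ _ _)
    (pow_nonneg (sq_nonneg _) _)
  · calc ∏ i, a (p.2.1 i) ^ 2 ≤ ∏ _i : Fin r, Ca ^ 2 :=
          Finset.prod_le_prod (fun _ _ => sq_nonneg _) fun i _ => by
            rw [← abs_sq, abs_pow]; exact pow_le_pow_left₀ (abs_nonneg _) (haC _) 2
      _ = (Ca ^ 2) ^ r := by rw [Finset.prod_const, Finset.card_univ, Fintype.card_fin]
  · calc ∏ b : Fin (r + 1), tempKernel src tgt w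
            ((Fin.cons p.1.1 (Fin.snoc p.2.1 p.1.2) : Fin (r + 2) → Λ → H) (Fin.castSucc b)) (p.2.2 b)
            ((Fin.cons p.1.1 (Fin.snoc p.2.1 p.1.2) : Fin (r + 2) → Λ → H) (Fin.succ b))
          ≤ ∏ _b : Fin (r + 1), Cw ^ Fintype.card Λ :=
          Finset.prod_le_prod (fun _ _ => tempKernel_nonneg src tgt w hw0 _ _ _) fun b _ =>
            tempKernel_le_pow src tgt w hw0 hwC _ _ _
      _ = (Cw ^ Fintype.card Λ) ^ (r + 1) := by rw [Finset.prod_const, Finset.card_univ, Fintype.card_fin]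

omit [CompactSpace H] in
/-- The block integrand `F(pad(u ∷ x :: v), pad(layers)) · slab weight` is jointly measurable. -/
theorem measurable_blockIntegrand (hw : Continuous w) (ha : Measurable a) (M r : ℕ)
    {F : (Fin ((M + 3) + (r + 2)) → Λ → H) × (Fin ((M + 3) + (r + 2)) → P → H) → ℝ} (hFm : Measurable F) :
    Measurable fun p : ((Λ → H) × (Λ → H)) × ((Fin r → Λ → H) × (Fin (r + 1) → P → H)) =>
      F (padV M (Fin.cons p.1.1 (Fin.snoc p.2.1 p.1.2)), padE M p.2.2) *
        ((∏ i, a (p.2.1 i) ^ 2) * ∏ b : Fin (r + 1), tempKernel src tgt w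
          ((Fin.cons p.1.1 (Fin.snoc p.2.1 p.1.2) : Fin (r + 2) → Λ → H) (Fin.castSucc b)) (p.2.2 b)
          ((Fin.cons p.1.1 (Fin.snoc p.2.1 p.1.2) : Fin (r + 2) → Λ → H) (Fin.succ b))) := by
  have hch : Measurable fun p : ((Λ → H) × (Λ → H)) × ((Fin r → Λ → H) × (Fin (r + 1) → P → H)) =>
      (Fin.cons p.1.1 (Fin.snoc p.2.1 p.1.2) : Fin (r + 2) → Λ → H) :=
    (measurable_consSnoc r).comp (measurable_fst.prodMk (measurable_fst.comp measurable_snd))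
  exact (hFm.comp (((measurable_padV M).comp hch).prodMk
    ((measurable_padE M).comp (measurable_snd.comp measurable_snd)))).mul (measurable_slabWeight src tgt w a hw ha r)

omit [Fintype P] [TopologicalSpace H] [IsTopologicalGroup H] [CompactSpace H] [MeasurableSpace H] [BorelSpace H]
  [SecondCountableTopology H] in
theorem norm_blockIntegrand_le (hw0 : ∀ h, 0 ≤ w h) {Cw : ℝ} (hwC : ∀ h, w h ≤ Cw) {Ca : ℝ}
    (haC : ∀ V, |a V| ≤ Ca) (M r : ℕ)
    {F : (Fin ((M + 3) + (r + 2)) → Λ → H) × (Fin ((M + 3) + (r + 2)) → P → H) → ℝ} {nrm : ℝ}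
    (hFb : ∀ q, |F q| ≤ nrm) (p : ((Λ → H) × (Λ → H)) × ((Fin r → Λ → H) × (Fin (r + 1) → P → H))) :
    ‖F (padV M (Fin.cons p.1.1 (Fin.snoc p.2.1 p.1.2)), padE M p.2.2) *
        ((∏ i, a (p.2.1 i) ^ 2) * ∏ b : Fin (r + 1), tempKernel src tgt w
          ((Fin.cons p.1.1 (Fin.snoc p.2.1 p.1.2) : Fin (r + 2) → Λ → H) (Fin.castSucc b)) (p.2.2 b)
          ((Fin.cons p.1.1 (Fin.snoc p.2.1 p.1.2) : Fin (r + 2) → Λ → H) (Fin.succ b)))‖ ≤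
      nrm * ((Ca ^ 2) ^ r * (Cw ^ Fintype.card Λ) ^ (r + 1)) := by
  rw [norm_mul, Real.norm_eq_abs, Real.norm_eq_abs, abs_of_nonneg (slabWeight_nonneg src tgt w a hw0 p)]
  exact mul_le_mul (hFb _) (slabWeight_le src tgt w a hw0 hwC haC p) (slabWeight_nonneg src tgt w a hw0 p)
    ((abs_nonneg _).trans (hFb (padV M (Fin.cons p.1.1 (Fin.snoc p.2.1 p.1.2)), padE M p.2.2)))

/-- The block kernel is jointly strongly measurable. -/
theorem stronglyMeasurable_uncurry_blockKernel (hw : Continuous w) (ha : Measurable a) (M r : ℕ)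
    {F : (Fin ((M + 3) + (r + 2)) → Λ → H) × (Fin ((M + 3) + (r + 2)) → P → H) → ℝ} (hFm : Measurable F) :
    StronglyMeasurable (uncurry (blockKernel src tgt w a M r F)) := by
  have hI := (measurable_blockIntegrand src tgt w a hw ha M r hFm).stronglyMeasurable.integral_prod_right'
    (ν := (Measure.pi fun _ => Measure.pi fun _ : Λ => haarProbability H).prod
      (Measure.pi fun _ => Measure.pi fun _ : P => haarProbability H))
  have h1 : StronglyMeasurable fun p : (Λ → H) × (Λ → H) => a p.1 := (ha.comp measurable_fst).stronglyMeasurable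
  have h2 : StronglyMeasurable fun p : (Λ → H) × (Λ → H) => a p.2 := (ha.comp measurable_snd).stronglyMeasurable
  exact (h1.mul hI).mul h2

omit [SecondCountableTopology H] in
/-- A uniform bound of the block kernel. -/
theorem norm_blockKernel_le (hw0 : ∀ h, 0 ≤ w h) {Cw : ℝ} (hwC : ∀ h, w h ≤ Cw) {Ca : ℝ}
    (haC : ∀ V, |a V| ≤ Ca) (M r : ℕ)
    {F : (Fin ((M + 3) + (r + 2)) → Λ → H) × (Fin ((M + 3) + (r + 2)) → P → H) → ℝ} {nrm : ℝ}
    (hFb : ∀ q, |F q| ≤ nrm) (u v : Λ → H) :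
    ‖blockKernel src tgt w a M r F u v‖ ≤ Ca * (nrm * ((Ca ^ 2) ^ r * (Cw ^ Fintype.card Λ) ^ (r + 1))) * Ca := by
  have ha0 : 0 ≤ Ca := (abs_nonneg _).trans (haC u)
  have hI := norm_integral_le_of_norm_le_const (Eventually.of_forall fun q =>
    norm_blockIntegrand_le src tgt w a hw0 hwC haC M r hFb ((u, v), q))
    (μ := (Measure.pi fun _ => Measure.pi fun _ : Λ => haarProbability H).prod
      (Measure.pi fun _ => Measure.pi fun _ : P => haarProbability H))
  rw [probReal_univ, mul_one] at hI
  unfold blockKernel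
  rw [norm_mul, norm_mul, Real.norm_eq_abs (a u), Real.norm_eq_abs (a v)]
  exact mul_le_mul (mul_le_mul (haC u) hI (norm_nonneg _) ha0) (haC v) (abs_nonneg _)
    (mul_nonneg ha0 ((norm_nonneg _).trans hI))

/-- **Path-kernel domination of the block kernel**: `|Bk(u, v)| ≤ nrm · pathK μ K r u v` for `|F| ≤ nrm` and
`0 ≤ a` (§6 `integral_slab_eq_integral_pathChain` + `abs_mul_integral_mul_mul_le`). -/
theorem abs_blockKernel_le_pathK (hw : Continuous w) (hw0 : ∀ h, 0 ≤ w h) {Cw : ℝ} (hwC : ∀ h, w h ≤ Cw)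
    (ha : Measurable a) {Ca : ℝ} (haC : ∀ V, |a V| ≤ Ca) (ha0 : ∀ V, 0 ≤ a V) (M r : ℕ)
    {F : (Fin ((M + 3) + (r + 2)) → Λ → H) × (Fin ((M + 3) + (r + 2)) → P → H) → ℝ} (hFm : Measurable F)
    {nrm : ℝ} (hFb : ∀ q, |F q| ≤ nrm) (u v : Λ → H) :
    |blockKernel src tgt w a M r F u v| ≤
      nrm * pathK (Measure.pi fun _ : Λ => haarProbability H) (sandKernel src tgt w a) r u v := by
  unfold blockKernel pathK
  rw [← integral_slab_eq_integral_pathChain src tgt w a hw hw0 hwC ha haC r u v]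
  have hGm := (measurable_slabWeight src tgt w a hw ha r).comp
    (measurable_const.prodMk measurable_id : Measurable fun q : (Fin r → Λ → H) × (Fin (r + 1) → P → H) =>
      (((u, v) : (Λ → H) × (Λ → H)), q))
  have hFGm := (measurable_blockIntegrand src tgt w a hw ha M r hFm).comp
    (measurable_const.prodMk measurable_id : Measurable fun q : (Fin r → Λ → H) × (Fin (r + 1) → P → H) =>
      (((u, v) : (Λ → H) × (Λ → H)), q))
  refine abs_mul_integral_mul_mul_le _ (ha0 u) (ha0 v) (fun q => slabWeight_nonneg src tgt w a hw0 ((u, v), q))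
    (fun q => hFb _) ?_ ?_
  · refine (integrable_const ((Ca ^ 2) ^ r * (Cw ^ Fintype.card Λ) ^ (r + 1))).mono'
      hGm.aestronglyMeasurable (Eventually.of_forall fun q => ?_)
    rw [Real.norm_eq_abs, abs_of_nonneg (slabWeight_nonneg src tgt w a hw0 ((u, v), q))]
    exact slabWeight_le src tgt w a hw0 hwC haC ((u, v), q)
  · exact (integrable_const _).mono' hFGm.aestronglyMeasurable
      (Eventually.of_forall fun q => norm_blockIntegrand_le src tgt w a hw0 hwC haC M r hFb ((u, v), q))


end Block

/-! ## PART 2 — Stage A (layers at fixed slices) and the block's layer integral -/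

section BlockCore

variable {P Λ H : Type*} [Fintype P] [Fintype Λ] [Group H] [TopologicalSpace H] [IsTopologicalGroup H]
  [CompactSpace H] [MeasurableSpace H] [BorelSpace H] (src tgt : Λ → P) (w : H → ℝ) (a : (Λ → H) → ℝ)

variable [SecondCountableTopology H]

/-! ### Peeling one coordinate of a product integral -/

omit [SecondCountableTopology H] in
/-- `∫ f(E ∘ castSucc) g(E last) dν^{n+1} = (∫ f dν^n) (∫ g dν)` (Mathlib `measurePreserving_piFinSuccAbove` at the
pivot `last`). -/
theorem integral_peel_last {Y : Type*} [MeasurableSpace Y] (ν : Measure Y) [SigmaFinite ν] (n : ℕ)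
    (f : (Fin n → Y) → ℝ) (g : Y → ℝ) :
    ∫ E : Fin (n + 1) → Y, f (fun b => E (Fin.castSucc b)) * g (E (Fin.last n)) ∂(Measure.pi fun _ => ν) =
      (∫ Eb, f Eb ∂(Measure.pi fun _ => ν)) * ∫ y, g y ∂ν := by
  have he : MeasurePreserving (MeasurableEquiv.piFinSuccAbove (fun _ : Fin (n + 1) => Y) (Fin.last n))
      (Measure.pi fun _ => ν) (ν.prod (Measure.pi fun _ : Fin n => ν)) :=
    measurePreserving_piFinSuccAbove (fun _ : Fin (n + 1) => ν) (Fin.last n)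
  have h2 : ∀ E : Fin (n + 1) → Y,
      (MeasurableEquiv.piFinSuccAbove (fun _ : Fin (n + 1) => Y) (Fin.last n) E).2 =
        fun b => E (Fin.castSucc b) := by
    intro E; funext b
    show E ((Fin.last n).succAbove b) = E (Fin.castSucc b)
    rw [Fin.succAbove_last]
  have h1 : ∀ E : Fin (n + 1) → Y,
      (MeasurableEquiv.piFinSuccAbove (fun _ : Fin (n + 1) => Y) (Fin.last n) E).1 = E (Fin.last n) :=
    fun E => rfl
  calc ∫ E : Fin (n + 1) → Y, f (fun b => E (Fin.castSucc b)) * g (E (Fin.last n)) ∂(Measure.pi fun _ => ν)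
      = ∫ E : Fin (n + 1) → Y, (fun p : Y × (Fin n → Y) => g p.1 * f p.2)
          (MeasurableEquiv.piFinSuccAbove (fun _ : Fin (n + 1) => Y) (Fin.last n) E) ∂(Measure.pi fun _ => ν) := by
        refine integral_congr_ae (Eventually.of_forall fun E => ?_)
        dsimp only
        rw [h1, h2, mul_comm]
    _ = ∫ p, g p.1 * f p.2 ∂(ν.prod (Measure.pi fun _ : Fin n => ν)) :=
        he.integral_comp' (fun p : Y × (Fin n → Y) => g p.1 * f p.2)
    _ = (∫ y, g y ∂ν) * ∫ Eb, f Eb ∂(Measure.pi fun _ => ν) := integral_prod_mul (μ := ν) g f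
    _ = _ := mul_comm _ _

omit [SecondCountableTopology H] in
/-- **Fubini along `Fin.snoc`**: `∫ Φ dρ^{⊗(n+1)} = ∫ (∫ Φ(x :: y) dρ^{⊗n}(x)) dρ(y)` for a bounded measurable `Φ`
(the `snoc` twin of the tree's `integral_pi_succ_eq_integral_cons`). -/
theorem integral_pi_succ_eq_integral_snoc {Y : Type*} [MeasurableSpace Y] (ρ : Measure Y) [IsFiniteMeasure ρ]
    (n : ℕ) {Φ : (Fin (n + 1) → Y) → ℝ} (hΦ : Measurable Φ) {B : ℝ} (hΦb : ∀ W, ‖Φ W‖ ≤ B) :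
    ∫ W, Φ W ∂(Measure.pi fun _ : Fin (n + 1) => ρ) =
      ∫ y, ∫ x : Fin n → Y, Φ (Fin.snoc x y) ∂(Measure.pi fun _ => ρ) ∂ρ := by
  have hmp : MeasurePreserving (MeasurableEquiv.piFinSuccAbove (fun _ : Fin (n + 1) => Y) (Fin.last n)).symm
      (ρ.prod (Measure.pi fun _ : Fin n => ρ)) (Measure.pi fun _ => ρ) :=
    (measurePreserving_piFinSuccAbove (fun _ : Fin (n + 1) => ρ) (Fin.last n)).symm
  have he : ∀ p : Y × (Fin n → Y),
      (MeasurableEquiv.piFinSuccAbove (fun _ : Fin (n + 1) => Y) (Fin.last n)).symm p = Fin.snoc p.2 p.1 := by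
    intro p
    show (Fin.insertNth (α := fun _ => Y) (Fin.last n) p.1 p.2 : Fin (n + 1) → Y) = Fin.snoc p.2 p.1
    exact Fin.insertNth_last' p.1 p.2
  have h1 : ∫ W, Φ W ∂(Measure.pi fun _ : Fin (n + 1) => ρ) =
      ∫ p, Φ (Fin.snoc p.2 p.1) ∂(ρ.prod (Measure.pi fun _ : Fin n => ρ)) := by
    rw [← hmp.integral_comp']
    refine integral_congr_ae (Eventually.of_forall fun p => ?_)
    dsimp only
    rw [he]
  rw [h1]
  have hcm : Measurable fun p : Y × (Fin n → Y) => (Fin.snoc p.2 p.1 : Fin (n + 1) → Y) :=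
    (Literature.Analysis.OperatorTheory.measurable_finSnoc n).comp (measurable_snd.prodMk measurable_fst)
  have hint : Integrable (fun p : Y × (Fin n → Y) => Φ (Fin.snoc p.2 p.1)) (ρ.prod (Measure.pi fun _ : Fin n => ρ)) :=
    (integrable_const B).mono' (hΦ.comp hcm).aestronglyMeasurable (Eventually.of_forall fun p => hΦb _)
  rw [integral_prod _ hint]

omit [Fintype P] [Fintype Λ] [Group H] [TopologicalSpace H] [IsTopologicalGroup H] [CompactSpace H]
  [MeasurableSpace H] [BorelSpace H] [SecondCountableTopology H] in
theorem consSnoc_last {α : Type*} {r : ℕ} (u v : α) (x : Fin r → α) :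
    (Fin.cons u (Fin.snoc x v) : Fin (r + 2) → α) (Fin.last (r + 1)) = v := by
  rw [← Fin.succ_last, Fin.cons_succ, Fin.snoc_last]

omit [Fintype P] [Fintype Λ] [Group H] [TopologicalSpace H] [IsTopologicalGroup H] [CompactSpace H]
  [MeasurableSpace H] [BorelSpace H] [SecondCountableTopology H] in
theorem consSnoc_castSucc_succ {α : Type*} {r : ℕ} (u v : α) (x : Fin r → α) (k : Fin r) :
    (Fin.cons u (Fin.snoc x v) : Fin (r + 2) → α) k.castSucc.succ = x k := by
  rw [Fin.cons_succ, Fin.snoc_castSucc]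

/-! ### Stage A: integrating out the temporal layers at fixed slices -/

omit [SecondCountableTopology H] in
set_option maxHeartbeats 400000 in
/-- **The layers at fixed slices.**  With the seam `z` on the layer after the block and the species depending only
on the block slices and the block's first `r + 1` layers, the integral over ALL temporal layers of
`F · ∏ₜ tempKernel (V t) (E t) (seam • V (t+1))` is (product of the outer bond kernels) · (seam bond kernel) ·
(the block's layer integral).  `Fin.prod_univ_add`, the splitting `finSplit`, `integral_prod_mul`,
`integral_prod_tempKernel_pi`, `integral_peel_last`. -/
theorem integral_layers_fixedSlices (M r : ℕ)
    {F : (Fin ((M + 3) + (r + 2)) → Λ → H) × (Fin ((M + 3) + (r + 2)) → P → H) → ℝ}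
    (hFdep : ∀ q q' : (Fin ((M + 3) + (r + 2)) → Λ → H) × (Fin ((M + 3) + (r + 2)) → P → H),
      (∀ i, q.1 (Fin.natAdd (M + 3) i) = q'.1 (Fin.natAdd (M + 3) i)) →
      (∀ b : Fin (r + 1), q.2 (Fin.natAdd (M + 3) (Fin.castSucc b)) = q'.2 (Fin.natAdd (M + 3) (Fin.castSucc b))) →
        F q = F q')
    {z : Λ → H} {sm : Fin ((M + 3) + (r + 2)) → Λ → H} (hsm₁ : sm (Fin.natAdd (M + 3) (Fin.last (r + 1))) = z)
    (hsm₀ : ∀ t, t ≠ Fin.natAdd (M + 3) (Fin.last (r + 1)) → sm t = 1)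
    (V : Fin ((M + 3) + (r + 2)) → Λ → H) :
    ∫ E : Fin ((M + 3) + (r + 2)) → P → H,
        F (V, E) * ∏ t, tempKernel src tgt w (V t) (E t) (ctwist (sm t) (V (finRotate _ t)))
      ∂(Measure.pi fun _ => Measure.pi fun _ : P => haarProbability H) =
    ((∏ j : Fin (M + 2), avgKernel src tgt w (V (Fin.castAdd (r + 2) (Fin.castSucc j)))
        (V (Fin.castAdd (r + 2) j.succ))) *
      avgKernel src tgt w (V (Fin.castAdd (r + 2) (Fin.last (M + 2)))) (V (Fin.natAdd (M + 3) 0))) *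
    (avgKernel src tgt w (V (Fin.natAdd (M + 3) (Fin.last (r + 1)))) (ctwist z (V (Fin.castAdd (r + 2) 0))) *
      ∫ Eb : Fin (r + 1) → P → H, F (V, padE M Eb) *
        ∏ b, tempKernel src tgt w (V (Fin.natAdd (M + 3) (Fin.castSucc b))) (Eb b) (V (Fin.natAdd (M + 3) b.succ))
        ∂(Measure.pi fun _ => Measure.pi fun _ : P => haarProbability H)) := by
  have he : MeasurePreserving (finSplit (P → H) (M + 3) (r + 2))
      (Measure.pi fun _ => Measure.pi fun _ : P => haarProbability H)
      ((Measure.pi fun _ : Fin (M + 3) => Measure.pi fun _ : P => haarProbability H).prod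
        (Measure.pi fun _ : Fin (r + 2) => Measure.pi fun _ : P => haarProbability H)) :=
    measurePreserving_finSplit' _ (M + 3) (r + 2)
  -- the integrand read through the splitting of the layers into (outer, block ∪ seam)
  have hpt : ∀ E : Fin ((M + 3) + (r + 2)) → P → H,
      F (V, E) * ∏ t, tempKernel src tgt w (V t) (E t) (ctwist (sm t) (V (finRotate _ t))) =
        (∏ j : Fin (M + 3), tempKernel src tgt w (V (Fin.castAdd (r + 2) j))
            ((finSplit (P → H) (M + 3) (r + 2) E).1 j) (V (finRotate _ (Fin.castAdd (r + 2) j)))) *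
          ((F (V, padE M (fun b => (finSplit (P → H) (M + 3) (r + 2) E).2 (Fin.castSucc b))) *
              ∏ b : Fin (r + 1), tempKernel src tgt w (V (Fin.natAdd (M + 3) (Fin.castSucc b)))
                ((finSplit (P → H) (M + 3) (r + 2) E).2 (Fin.castSucc b)) (V (Fin.natAdd (M + 3) b.succ))) *
            tempKernel src tgt w (V (Fin.natAdd (M + 3) (Fin.last (r + 1))))
              ((finSplit (P → H) (M + 3) (r + 2) E).2 (Fin.last (r + 1))) (ctwist z (V (Fin.castAdd (r + 2) 0)))) := by
    intro E
    have hF : F (V, E) = F (V, padE M (fun b => E (Fin.natAdd (M + 3) (Fin.castSucc b)))) :=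
      hFdep _ _ (fun i => rfl) (fun b => by simp only [padE_natAdd_castSucc])
    have h1 : ∀ j : Fin (M + 3), ctwist (sm (Fin.castAdd (r + 2) j)) (V (finRotate _ (Fin.castAdd (r + 2) j))) =
        V (finRotate _ (Fin.castAdd (r + 2) j)) := fun j => by
      rw [hsm₀ _ (castAdd_ne_natAdd_last M r j)]; exact congrFun ctwist_one _
    have h2 : ∀ b : Fin (r + 1), ctwist (sm (Fin.natAdd (M + 3) (Fin.castSucc b)))
        (V (finRotate _ (Fin.natAdd (M + 3) (Fin.castSucc b)))) = V (Fin.natAdd (M + 3) b.succ) := fun b => by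
      rw [hsm₀ _ (natAdd_castSucc_ne_natAdd_last M r b), finRotate_natAdd_castSucc]; exact congrFun ctwist_one _
    have h3 : ctwist (sm (Fin.natAdd (M + 3) (Fin.last (r + 1))))
        (V (finRotate _ (Fin.natAdd (M + 3) (Fin.last (r + 1))))) = ctwist z (V (Fin.castAdd (r + 2) 0)) := by
      rw [hsm₁, finRotate_natAdd_last]
    have hcs : ∏ i : Fin (r + 2), tempKernel src tgt w (V (Fin.natAdd (M + 3) i)) (E (Fin.natAdd (M + 3) i))
          (ctwist (sm (Fin.natAdd (M + 3) i)) (V (finRotate _ (Fin.natAdd (M + 3) i)))) =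
        (∏ b : Fin (r + 1), tempKernel src tgt w (V (Fin.natAdd (M + 3) (Fin.castSucc b)))
            (E (Fin.natAdd (M + 3) (Fin.castSucc b)))
            (ctwist (sm (Fin.natAdd (M + 3) (Fin.castSucc b)))
              (V (finRotate _ (Fin.natAdd (M + 3) (Fin.castSucc b)))))) *
          tempKernel src tgt w (V (Fin.natAdd (M + 3) (Fin.last (r + 1)))) (E (Fin.natAdd (M + 3) (Fin.last (r + 1))))
            (ctwist (sm (Fin.natAdd (M + 3) (Fin.last (r + 1))))
              (V (finRotate _ (Fin.natAdd (M + 3) (Fin.last (r + 1)))))) :=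
      Fin.prod_univ_castSucc _
    rw [hF, Fin.prod_univ_add, hcs]
    simp only [h1, h2, h3, finSplit_fst, finSplit_snd]
    ring
  have hA : ∫ E₁ : Fin (M + 3) → P → H, ∏ j, tempKernel src tgt w (V (Fin.castAdd (r + 2) j)) (E₁ j)
        (V (finRotate _ (Fin.castAdd (r + 2) j))) ∂(Measure.pi fun _ => Measure.pi fun _ : P => haarProbability H) =
      ∏ j, avgKernel src tgt w (V (Fin.castAdd (r + 2) j)) (V (finRotate _ (Fin.castAdd (r + 2) j))) :=
    integral_prod_tempKernel_pi src tgt w (fun j => V (Fin.castAdd (r + 2) j))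
      (fun j => V (finRotate _ (Fin.castAdd (r + 2) j)))
  have hA' : ∏ j : Fin (M + 3), avgKernel src tgt w (V (Fin.castAdd (r + 2) j)) (V (finRotate _ (Fin.castAdd (r + 2) j))) =
      (∏ j : Fin (M + 2), avgKernel src tgt w (V (Fin.castAdd (r + 2) (Fin.castSucc j)))
        (V (Fin.castAdd (r + 2) j.succ))) *
      avgKernel src tgt w (V (Fin.castAdd (r + 2) (Fin.last (M + 2)))) (V (Fin.natAdd (M + 3) 0)) := by
    rw [Fin.prod_univ_castSucc]
    simp only [finRotate_castAdd_castSucc, finRotate_castAdd_last]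
  have hB : ∫ E₂ : Fin (r + 2) → P → H, (F (V, padE M (fun b => E₂ (Fin.castSucc b))) *
        ∏ b : Fin (r + 1), tempKernel src tgt w (V (Fin.natAdd (M + 3) (Fin.castSucc b)))
          (E₂ (Fin.castSucc b)) (V (Fin.natAdd (M + 3) b.succ))) *
        tempKernel src tgt w (V (Fin.natAdd (M + 3) (Fin.last (r + 1)))) (E₂ (Fin.last (r + 1)))
          (ctwist z (V (Fin.castAdd (r + 2) 0))) ∂(Measure.pi fun _ => Measure.pi fun _ : P => haarProbability H) =
      (∫ Eb : Fin (r + 1) → P → H, F (V, padE M Eb) *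
        ∏ b, tempKernel src tgt w (V (Fin.natAdd (M + 3) (Fin.castSucc b))) (Eb b) (V (Fin.natAdd (M + 3) b.succ))
        ∂(Measure.pi fun _ => Measure.pi fun _ : P => haarProbability H)) *
      avgKernel src tgt w (V (Fin.natAdd (M + 3) (Fin.last (r + 1)))) (ctwist z (V (Fin.castAdd (r + 2) 0))) :=
    integral_peel_last _ (r + 1) (fun Eb : Fin (r + 1) → P → H => F (V, padE M Eb) *
        ∏ b, tempKernel src tgt w (V (Fin.natAdd (M + 3) (Fin.castSucc b))) (Eb b) (V (Fin.natAdd (M + 3) b.succ)))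
      (fun y => tempKernel src tgt w (V (Fin.natAdd (M + 3) (Fin.last (r + 1)))) y (ctwist z (V (Fin.castAdd (r + 2) 0))))
  calc ∫ E : Fin ((M + 3) + (r + 2)) → P → H,
        F (V, E) * ∏ t, tempKernel src tgt w (V t) (E t) (ctwist (sm t) (V (finRotate _ t)))
        ∂(Measure.pi fun _ => Measure.pi fun _ : P => haarProbability H)
      = ∫ E : Fin ((M + 3) + (r + 2)) → P → H, (fun pE : (Fin (M + 3) → P → H) × (Fin (r + 2) → P → H) =>
          (∏ j : Fin (M + 3), tempKernel src tgt w (V (Fin.castAdd (r + 2) j)) (pE.1 j)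
              (V (finRotate _ (Fin.castAdd (r + 2) j)))) *
            ((F (V, padE M (fun b => pE.2 (Fin.castSucc b))) *
                ∏ b : Fin (r + 1), tempKernel src tgt w (V (Fin.natAdd (M + 3) (Fin.castSucc b)))
                  (pE.2 (Fin.castSucc b)) (V (Fin.natAdd (M + 3) b.succ))) *
              tempKernel src tgt w (V (Fin.natAdd (M + 3) (Fin.last (r + 1)))) (pE.2 (Fin.last (r + 1)))
                (ctwist z (V (Fin.castAdd (r + 2) 0)))))
          (finSplit (P → H) (M + 3) (r + 2) E) ∂(Measure.pi fun _ => Measure.pi fun _ : P => haarProbability H) :=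
        integral_congr_ae (Eventually.of_forall hpt)
    _ = ∫ pE : (Fin (M + 3) → P → H) × (Fin (r + 2) → P → H),
          (∏ j : Fin (M + 3), tempKernel src tgt w (V (Fin.castAdd (r + 2) j)) (pE.1 j)
              (V (finRotate _ (Fin.castAdd (r + 2) j)))) *
            ((F (V, padE M (fun b => pE.2 (Fin.castSucc b))) *
                ∏ b : Fin (r + 1), tempKernel src tgt w (V (Fin.natAdd (M + 3) (Fin.castSucc b)))
                  (pE.2 (Fin.castSucc b)) (V (Fin.natAdd (M + 3) b.succ))) *
              tempKernel src tgt w (V (Fin.natAdd (M + 3) (Fin.last (r + 1)))) (pE.2 (Fin.last (r + 1)))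
                (ctwist z (V (Fin.castAdd (r + 2) 0))))
        ∂((Measure.pi fun _ : Fin (M + 3) => Measure.pi fun _ : P => haarProbability H).prod
          (Measure.pi fun _ : Fin (r + 2) => Measure.pi fun _ : P => haarProbability H)) :=
        he.integral_comp' (fun pE : (Fin (M + 3) → P → H) × (Fin (r + 2) → P → H) =>
          (∏ j : Fin (M + 3), tempKernel src tgt w (V (Fin.castAdd (r + 2) j)) (pE.1 j)
              (V (finRotate _ (Fin.castAdd (r + 2) j)))) *
            ((F (V, padE M (fun b => pE.2 (Fin.castSucc b))) *
                ∏ b : Fin (r + 1), tempKernel src tgt w (V (Fin.natAdd (M + 3) (Fin.castSucc b)))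
                  (pE.2 (Fin.castSucc b)) (V (Fin.natAdd (M + 3) b.succ))) *
              tempKernel src tgt w (V (Fin.natAdd (M + 3) (Fin.last (r + 1)))) (pE.2 (Fin.last (r + 1)))
                (ctwist z (V (Fin.castAdd (r + 2) 0)))))
    _ = (∫ E₁ : Fin (M + 3) → P → H, ∏ j, tempKernel src tgt w (V (Fin.castAdd (r + 2) j)) (E₁ j)
          (V (finRotate _ (Fin.castAdd (r + 2) j))) ∂(Measure.pi fun _ => Measure.pi fun _ : P => haarProbability H)) *
        ∫ E₂ : Fin (r + 2) → P → H, (F (V, padE M (fun b => E₂ (Fin.castSucc b))) *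
          ∏ b : Fin (r + 1), tempKernel src tgt w (V (Fin.natAdd (M + 3) (Fin.castSucc b)))
            (E₂ (Fin.castSucc b)) (V (Fin.natAdd (M + 3) b.succ))) *
          tempKernel src tgt w (V (Fin.natAdd (M + 3) (Fin.last (r + 1)))) (E₂ (Fin.last (r + 1)))
            (ctwist z (V (Fin.castAdd (r + 2) 0))) ∂(Measure.pi fun _ => Measure.pi fun _ : P => haarProbability H) :=
        integral_prod_mul (μ := Measure.pi fun _ : Fin (M + 3) => Measure.pi fun _ : P => haarProbability H)
          (ν := Measure.pi fun _ : Fin (r + 2) => Measure.pi fun _ : P => haarProbability H)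
          (fun E₁ : Fin (M + 3) → P → H => ∏ j, tempKernel src tgt w (V (Fin.castAdd (r + 2) j)) (E₁ j)
            (V (finRotate _ (Fin.castAdd (r + 2) j))))
          (fun E₂ : Fin (r + 2) → P → H => (F (V, padE M (fun b => E₂ (Fin.castSucc b))) *
            ∏ b : Fin (r + 1), tempKernel src tgt w (V (Fin.natAdd (M + 3) (Fin.castSucc b)))
              (E₂ (Fin.castSucc b)) (V (Fin.natAdd (M + 3) b.succ))) *
            tempKernel src tgt w (V (Fin.natAdd (M + 3) (Fin.last (r + 1)))) (E₂ (Fin.last (r + 1)))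
              (ctwist z (V (Fin.castAdd (r + 2) 0))))
    _ = _ := by rw [hA, hA', hB]; ring

/-! ### The block's layer integral `core` and Stage C: the block as a one-bond insertion -/

/-- The block's layer integral: the species times the block's temporal kernels, integrated over the block's
`r + 1` temporal layers, as a function of the `r + 2` block slices. -/
def core (M r : ℕ) (F : (Fin ((M + 3) + (r + 2)) → Λ → H) × (Fin ((M + 3) + (r + 2)) → P → H) → ℝ)
    (Vb : Fin (r + 2) → Λ → H) : ℝ :=
  ∫ Eb : Fin (r + 1) → P → H, F (padV M Vb, padE M Eb) *
    ∏ b, tempKernel src tgt w (Vb (Fin.castSucc b)) (Eb b) (Vb b.succ)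
    ∂(Measure.pi fun _ => Measure.pi fun _ : P => haarProbability H)

omit [CompactSpace H] in
set_option maxHeartbeats 400000 in
/-- The block's layer integrand is jointly measurable in (slices, layers). -/
theorem measurable_coreIntegrand (hw : Continuous w) (M r : ℕ)
    {F : (Fin ((M + 3) + (r + 2)) → Λ → H) × (Fin ((M + 3) + (r + 2)) → P → H) → ℝ} (hFm : Measurable F) :
    Measurable fun p : (Fin (r + 2) → Λ → H) × (Fin (r + 1) → P → H) =>
      F (padV M p.1, padE M p.2) * ∏ b, tempKernel src tgt w (p.1 (Fin.castSucc b)) (p.2 b) (p.1 b.succ) := by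
  have hq1 : ∀ j : Fin (r + 2), Measurable fun p : (Fin (r + 2) → Λ → H) × (Fin (r + 1) → P → H) => p.1 j :=
    fun j => (measurable_pi_apply j).comp measurable_fst
  have hq2 : ∀ b : Fin (r + 1), Measurable fun p : (Fin (r + 2) → Λ → H) × (Fin (r + 1) → P → H) => p.2 b :=
    fun b => (measurable_pi_apply b).comp measurable_snd
  exact (hFm.comp (((measurable_padV M).comp measurable_fst).prodMk ((measurable_padE M).comp measurable_snd))).mul
    (Finset.measurable_prod _ fun b _ => (continuous_tempKernel src tgt w hw).measurable.comp
      ((hq1 (Fin.castSucc b)).prodMk ((hq2 b).prodMk (hq1 b.succ))))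

omit [Fintype P] [TopologicalSpace H] [IsTopologicalGroup H] [CompactSpace H] [MeasurableSpace H] [BorelSpace H]
  [SecondCountableTopology H] in
theorem norm_coreIntegrand_le (hw0 : ∀ h, 0 ≤ w h) {Cw : ℝ} (hwC : ∀ h, w h ≤ Cw) (M r : ℕ)
    {F : (Fin ((M + 3) + (r + 2)) → Λ → H) × (Fin ((M + 3) + (r + 2)) → P → H) → ℝ} {nrm : ℝ}
    (hFb : ∀ q, |F q| ≤ nrm) (p : (Fin (r + 2) → Λ → H) × (Fin (r + 1) → P → H)) :
    ‖F (padV M p.1, padE M p.2) * ∏ b, tempKernel src tgt w (p.1 (Fin.castSucc b)) (p.2 b) (p.1 b.succ)‖ ≤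
      nrm * (Cw ^ Fintype.card Λ) ^ (r + 1) := by
  have hP0 : 0 ≤ ∏ b, tempKernel src tgt w (p.1 (Fin.castSucc b)) (p.2 b) (p.1 b.succ) :=
    Finset.prod_nonneg fun _ _ => tempKernel_nonneg src tgt w hw0 _ _ _
  rw [norm_mul, Real.norm_eq_abs, Real.norm_eq_abs, abs_of_nonneg hP0]
  refine mul_le_mul (hFb _) ?_ hP0 ((abs_nonneg _).trans (hFb (padV M p.1, padE M p.2)))
  calc ∏ b, tempKernel src tgt w (p.1 (Fin.castSucc b)) (p.2 b) (p.1 b.succ)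
      ≤ ∏ _b : Fin (r + 1), Cw ^ Fintype.card Λ :=
        Finset.prod_le_prod (fun _ _ => tempKernel_nonneg src tgt w hw0 _ _ _) fun b _ =>
          tempKernel_le_pow src tgt w hw0 hwC _ _ _
    _ = (Cw ^ Fintype.card Λ) ^ (r + 1) := by rw [Finset.prod_const, Finset.card_univ, Fintype.card_fin]

theorem measurable_core (hw : Continuous w) (M r : ℕ)
    {F : (Fin ((M + 3) + (r + 2)) → Λ → H) × (Fin ((M + 3) + (r + 2)) → P → H) → ℝ} (hFm : Measurable F) :
    Measurable (core src tgt w M r F) :=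
  ((measurable_coreIntegrand src tgt w hw M r hFm).stronglyMeasurable.integral_prod_right'
    (ν := Measure.pi fun _ => Measure.pi fun _ : P => haarProbability H)).measurable

omit [SecondCountableTopology H] in
theorem norm_core_le (hw0 : ∀ h, 0 ≤ w h) {Cw : ℝ} (hwC : ∀ h, w h ≤ Cw) (M r : ℕ)
    {F : (Fin ((M + 3) + (r + 2)) → Λ → H) × (Fin ((M + 3) + (r + 2)) → P → H) → ℝ} {nrm : ℝ}
    (hFb : ∀ q, |F q| ≤ nrm) (Vb : Fin (r + 2) → Λ → H) :
    ‖core src tgt w M r F Vb‖ ≤ nrm * (Cw ^ Fintype.card Λ) ^ (r + 1) := by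
  have hI := norm_integral_le_of_norm_le_const (Eventually.of_forall fun Eb =>
    norm_coreIntegrand_le src tgt w hw0 hwC M r hFb (Vb, Eb))
    (μ := Measure.pi fun _ : Fin (r + 1) => Measure.pi fun _ : P => haarProbability H)
  rw [probReal_univ, mul_one] at hI
  exact hI

omit [SecondCountableTopology H] in
/-- The layer integral seen from the full slice configuration is `core` of the block slices. -/
theorem integral_blockLayers_eq_core (M r : ℕ)
    {F : (Fin ((M + 3) + (r + 2)) → Λ → H) × (Fin ((M + 3) + (r + 2)) → P → H) → ℝ}
    (hFdep : ∀ q q' : (Fin ((M + 3) + (r + 2)) → Λ → H) × (Fin ((M + 3) + (r + 2)) → P → H),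
      (∀ i, q.1 (Fin.natAdd (M + 3) i) = q'.1 (Fin.natAdd (M + 3) i)) →
      (∀ b : Fin (r + 1), q.2 (Fin.natAdd (M + 3) (Fin.castSucc b)) = q'.2 (Fin.natAdd (M + 3) (Fin.castSucc b))) →
        F q = F q')
    (V : Fin ((M + 3) + (r + 2)) → Λ → H) :
    ∫ Eb : Fin (r + 1) → P → H, F (V, padE M Eb) *
        ∏ b, tempKernel src tgt w (V (Fin.natAdd (M + 3) (Fin.castSucc b))) (Eb b) (V (Fin.natAdd (M + 3) b.succ))
        ∂(Measure.pi fun _ => Measure.pi fun _ : P => haarProbability H) =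
      core src tgt w M r F (fun i => V (Fin.natAdd (M + 3) i)) := by
  unfold core
  refine integral_congr_ae (Eventually.of_forall fun Eb => ?_)
  dsimp only
  rw [hFdep (V, padE M Eb) (padV M (fun i => V (Fin.natAdd (M + 3) i)), padE M Eb)
    (fun i => by simp only [padV_natAdd]) (fun b => rfl)]


/-! ### Measurability helpers (composition forms; avoid higher-order unification on `∘`) -/

omit [CompactSpace H] in
theorem measurable_tempKernel_comp₃ (hw : Continuous w) {α : Type*} [MeasurableSpace α] {f h : α → Λ → H}
    {g : α → P → H} (hf : Measurable f) (hg : Measurable g) (hh : Measurable h) :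
    Measurable fun x => tempKernel src tgt w (f x) (g x) (h x) := by
  have hm := (continuous_tempKernel src tgt w hw).measurable.comp (hf.prodMk (hg.prodMk hh))
  exact hm

theorem measurable_avgKernel_comp₂ (hw : Continuous w) {α : Type*} [MeasurableSpace α] {f g : α → Λ → H}
    (hf : Measurable f) (hg : Measurable g) : Measurable fun x => avgKernel src tgt w (f x) (g x) := by
  have hm := (stronglyMeasurable_uncurry_avgKernel src tgt w hw).measurable.comp (hf.prodMk hg)
  exact hm

theorem measurable_sandKernel_comp₂ (hw : Continuous w) (ha : Measurable a) {α : Type*} [MeasurableSpace α]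
    {f g : α → Λ → H} (hf : Measurable f) (hg : Measurable g) :
    Measurable fun x => sandKernel src tgt w a (f x) (g x) := by
  have hm := (stronglyMeasurable_uncurry_sandKernel src tgt w a hw ha).measurable.comp (hf.prodMk hg)
  exact hm

/-! ### Small inequality helpers -/

omit [Fintype P] [Fintype Λ] [Group H] [TopologicalSpace H] [IsTopologicalGroup H] [CompactSpace H]
  [MeasurableSpace H] [BorelSpace H] [SecondCountableTopology H] in
theorem abs_mul_le_mul {x y A B : ℝ} (hx : |x| ≤ A) (hy : |y| ≤ B) : |x * y| ≤ A * B := by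
  rw [abs_mul]; exact mul_le_mul hx hy (abs_nonneg _) ((abs_nonneg _).trans hx)

omit [Fintype P] [Fintype Λ] [Group H] [TopologicalSpace H] [IsTopologicalGroup H] [CompactSpace H]
  [MeasurableSpace H] [BorelSpace H] [SecondCountableTopology H] in
theorem abs_prod_sq_le {Ca : ℝ} (haC : ∀ V, |a V| ≤ Ca) {n : ℕ} (V : Fin n → Λ → H) :
    |∏ i, a (V i) ^ 2| ≤ (Ca ^ 2) ^ n := by
  rw [Finset.abs_prod]
  calc ∏ i, |a (V i) ^ 2| ≤ ∏ _i : Fin n, Ca ^ 2 :=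
        Finset.prod_le_prod (fun _ _ => abs_nonneg _) fun i _ => by
          rw [abs_pow]; exact pow_le_pow_left₀ (abs_nonneg _) (haC _) 2
    _ = (Ca ^ 2) ^ n := by rw [Finset.prod_const, Finset.card_univ, Fintype.card_fin]

omit [SecondCountableTopology H] in
theorem abs_prod_avgKernel_le (hw0 : ∀ h, 0 ≤ w h) {Cw : ℝ} (hwC : ∀ h, w h ≤ Cw) {n : ℕ}
    (V V' : Fin n → Λ → H) : |∏ j, avgKernel src tgt w (V j) (V' j)| ≤ (Cw ^ Fintype.card Λ) ^ n := by
  rw [Finset.abs_prod]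
  calc ∏ j, |avgKernel src tgt w (V j) (V' j)| ≤ ∏ _j : Fin n, Cw ^ Fintype.card Λ :=
        Finset.prod_le_prod (fun _ _ => abs_nonneg _) fun j _ => abs_avgKernel_le src tgt w hw0 hwC _ _
    _ = (Cw ^ Fintype.card Λ) ^ n := by rw [Finset.prod_const, Finset.card_univ, Fintype.card_fin]

omit [Fintype P] [TopologicalSpace H] [IsTopologicalGroup H] [CompactSpace H] [MeasurableSpace H] [BorelSpace H]
  [SecondCountableTopology H] in
theorem abs_prod_tempKernel_le (hw0 : ∀ h, 0 ≤ w h) {Cw : ℝ} (hwC : ∀ h, w h ≤ Cw) {ι : Type*} [Fintype ι]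
    (V V' : ι → Λ → H) (g : ι → P → H) :
    |∏ t, tempKernel src tgt w (V t) (g t) (V' t)| ≤ (Cw ^ Fintype.card Λ) ^ Fintype.card ι := by
  rw [Finset.abs_prod]
  calc ∏ t, |tempKernel src tgt w (V t) (g t) (V' t)| ≤ ∏ _t : ι, Cw ^ Fintype.card Λ :=
        Finset.prod_le_prod (fun _ _ => abs_nonneg _) fun t _ => abs_tempKernel_le_pow src tgt w hw0 hwC _ _ _
    _ = (Cw ^ Fintype.card Λ) ^ Fintype.card ι := by rw [Finset.prod_const, Finset.card_univ]

end BlockCore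

/-! ## PART 3 — Stage C (the block as a one-bond insertion) and Stages B+D (layers ↦ block chain) -/

section BlockChain

variable {P Λ H : Type*} [Fintype P] [Fintype Λ] [Group H] [TopologicalSpace H] [IsTopologicalGroup H]
  [CompactSpace H] [MeasurableSpace H] [BorelSpace H] (src tgt : Λ → P) (w : H → ℝ) (a : (Λ → H) → ℝ)

variable [SecondCountableTopology H]

/-! ### Stage C: the block integrates to the one-bond insertion `∫ K(p,u) Bk(u,v) K(z⁻¹•v, q)` -/

/-- The block kernel with its temporal layers integrated first: `a u · (∫ ∏ a(xₖ)² · core(u, x, v) dx) · a v`. -/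
theorem blockKernel_eq_integral_core (hw : Continuous w) (hw0 : ∀ h, 0 ≤ w h) {Cw : ℝ} (hwC : ∀ h, w h ≤ Cw)
    (ha : Measurable a) {Ca : ℝ} (haC : ∀ V, |a V| ≤ Ca) (M r : ℕ)
    {F : (Fin ((M + 3) + (r + 2)) → Λ → H) × (Fin ((M + 3) + (r + 2)) → P → H) → ℝ} (hFm : Measurable F)
    {nrm : ℝ} (hFb : ∀ q, |F q| ≤ nrm) (u v : Λ → H) :
    blockKernel src tgt w a M r F u v =
      a u * (∫ x : Fin r → Λ → H, (∏ k, a (x k) ^ 2) * core src tgt w M r F (Fin.cons u (Fin.snoc x v))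
        ∂(Measure.pi fun _ => Measure.pi fun _ : Λ => haarProbability H)) * a v := by
  have hpair : Measurable fun qq : (Fin r → Λ → H) × (Fin (r + 1) → P → H) =>
      (((u, v) : (Λ → H) × (Λ → H)), qq) := measurable_const.prodMk measurable_id
  have hmeas := (measurable_blockIntegrand src tgt w a hw ha M r hFm).comp hpair
  have hint : Integrable (fun qq : (Fin r → Λ → H) × (Fin (r + 1) → P → H) =>
      F (padV M (Fin.cons u (Fin.snoc qq.1 v)), padE M qq.2) *
        ((∏ i, a (qq.1 i) ^ 2) * ∏ b : Fin (r + 1), tempKernel src tgt w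
          ((Fin.cons u (Fin.snoc qq.1 v) : Fin (r + 2) → Λ → H) (Fin.castSucc b)) (qq.2 b)
          ((Fin.cons u (Fin.snoc qq.1 v) : Fin (r + 2) → Λ → H) (Fin.succ b))))
      ((Measure.pi fun _ => Measure.pi fun _ : Λ => haarProbability H).prod
        (Measure.pi fun _ => Measure.pi fun _ : P => haarProbability H)) :=
    (integrable_const (nrm * ((Ca ^ 2) ^ r * (Cw ^ Fintype.card Λ) ^ (r + 1)))).mono'
      hmeas.aestronglyMeasurable
      (Eventually.of_forall fun qq => norm_blockIntegrand_le src tgt w a hw0 hwC haC M r hFb ((u, v), qq))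
  unfold blockKernel
  rw [integral_prod _ hint]
  refine congrArg (fun t => a u * t * a v) (integral_congr_ae (Eventually.of_forall fun x => ?_))
  dsimp only
  unfold core
  rw [← integral_const_mul]
  refine integral_congr_ae (Eventually.of_forall fun Eb => ?_)
  dsimp only
  ring

set_option maxHeartbeats 400000 in
/-- **The block as a one-bond insertion.**  For fixed neighbour slices `p` (before the block) and `q` (after the
seam), the integral over the `r + 2` block slices of (bond into the block) · (seam bond out of the block) ·
(block magnetic weights) · (block layer integral), sandwiched by `a p`, `a q`, is
`∫∫ K(p, u) Bk(u, v) K(z⁻¹ • v, q) du dv` with `K = sandKernel`, `Bk = blockKernel`. -/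
theorem block_inner (hw : Continuous w) (hw0 : ∀ h, 0 ≤ w h) {Cw : ℝ} (hwC : ∀ h, w h ≤ Cw)
    (ha : Measurable a) {Ca : ℝ} (haC : ∀ V, |a V| ≤ Ca) {z : Λ → H} (hz : ∀ l, z l ∈ Subgroup.center H)
    (haT : ∀ V, a (ctwist z⁻¹ V) = a V) (M r : ℕ)
    {F : (Fin ((M + 3) + (r + 2)) → Λ → H) × (Fin ((M + 3) + (r + 2)) → P → H) → ℝ} (hFm : Measurable F)
    {nrm : ℝ} (hFb : ∀ q, |F q| ≤ nrm) (p q : Λ → H) :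
    a p * (∫ Vb : Fin (r + 2) → Λ → H,
        avgKernel src tgt w p (Vb 0) * (avgKernel src tgt w (Vb (Fin.last (r + 1))) (ctwist z q) *
          ((∏ i, a (Vb i) ^ 2) * core src tgt w M r F Vb))
      ∂(Measure.pi fun _ => Measure.pi fun _ : Λ => haarProbability H)) * a q =
    ∫ u, sandKernel src tgt w a p u *
        ∫ v, blockKernel src tgt w a M r F u v * sandKernel src tgt w a (ctwist z⁻¹ v) q
        ∂(Measure.pi fun _ : Λ => haarProbability H) ∂(Measure.pi fun _ : Λ => haarProbability H) := by
  -- the block-slice integrand: measurable and bounded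
  have hq1 : ∀ i : Fin (r + 2), Measurable fun Vb : Fin (r + 2) → Λ → H => Vb i := fun i => measurable_pi_apply i
  have hav0 : Measurable fun Vb : Fin (r + 2) → Λ → H => avgKernel src tgt w p (Vb 0) :=
    measurable_avgKernel_comp₂ src tgt w hw measurable_const (hq1 0)
  have hav1 : Measurable fun Vb : Fin (r + 2) → Λ → H =>
      avgKernel src tgt w (Vb (Fin.last (r + 1))) (ctwist z q) :=
    measurable_avgKernel_comp₂ src tgt w hw (hq1 (Fin.last (r + 1))) measurable_const
  have hpr : Measurable fun Vb : Fin (r + 2) → Λ → H => ∏ i, a (Vb i) ^ 2 :=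
    Finset.measurable_prod _ fun i _ => ((ha.comp (hq1 i)).pow_const 2)
  have hhm : Measurable fun Vb : Fin (r + 2) → Λ → H =>
      avgKernel src tgt w p (Vb 0) * (avgKernel src tgt w (Vb (Fin.last (r + 1))) (ctwist z q) *
        ((∏ i, a (Vb i) ^ 2) * core src tgt w M r F Vb)) :=
    hav0.mul (hav1.mul (hpr.mul (measurable_core src tgt w hw M r hFm)))
  have hhb : ∀ Vb : Fin (r + 2) → Λ → H,
      ‖avgKernel src tgt w p (Vb 0) * (avgKernel src tgt w (Vb (Fin.last (r + 1))) (ctwist z q) *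
        ((∏ i, a (Vb i) ^ 2) * core src tgt w M r F Vb))‖ ≤
        Cw ^ Fintype.card Λ * (Cw ^ Fintype.card Λ * ((Ca ^ 2) ^ (r + 2) * (nrm * (Cw ^ Fintype.card Λ) ^ (r + 1)))) := by
    intro Vb
    rw [Real.norm_eq_abs]
    refine abs_mul_le_mul (abs_avgKernel_le src tgt w hw0 hwC _ _)
      (abs_mul_le_mul (abs_avgKernel_le src tgt w hw0 hwC _ _)
        (abs_mul_le_mul (abs_prod_sq_le a haC Vb) ?_))
    rw [← Real.norm_eq_abs]; exact norm_core_le src tgt w hw0 hwC M r hFb Vb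
  have hconsm : ∀ u : Λ → H, Measurable fun W : Fin (r + 1) → Λ → H => (Fin.cons u W : Fin (r + 2) → Λ → H) :=
    fun u => (Literature.Analysis.OperatorTheory.measurable_finCons (r + 1)).comp
      (measurable_const.prodMk measurable_id)
  -- split off `u = Vb 0`, then `v = Vb (last)`
  rw [Literature.Analysis.OperatorTheory.integral_pi_succ_eq_integral_cons
    (ρ := Measure.pi fun _ : Λ => haarProbability H) (r + 1) hhm hhb]
  have hsnoc : ∀ u : Λ → H,
      ∫ W : Fin (r + 1) → Λ → H, avgKernel src tgt w p ((Fin.cons u W : Fin (r + 2) → Λ → H) 0) *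
          (avgKernel src tgt w ((Fin.cons u W : Fin (r + 2) → Λ → H) (Fin.last (r + 1))) (ctwist z q) *
            ((∏ i, a ((Fin.cons u W : Fin (r + 2) → Λ → H) i) ^ 2) *
              core src tgt w M r F (Fin.cons u W)))
        ∂(Measure.pi fun _ => Measure.pi fun _ : Λ => haarProbability H) =
      ∫ v, ∫ x : Fin r → Λ → H, avgKernel src tgt w p ((Fin.cons u (Fin.snoc x v) : Fin (r + 2) → Λ → H) 0) *
          (avgKernel src tgt w ((Fin.cons u (Fin.snoc x v) : Fin (r + 2) → Λ → H) (Fin.last (r + 1)))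
              (ctwist z q) *
            ((∏ i, a ((Fin.cons u (Fin.snoc x v) : Fin (r + 2) → Λ → H) i) ^ 2) *
              core src tgt w M r F (Fin.cons u (Fin.snoc x v))))
        ∂(Measure.pi fun _ => Measure.pi fun _ : Λ => haarProbability H)
        ∂(Measure.pi fun _ : Λ => haarProbability H) := fun u =>
    integral_pi_succ_eq_integral_snoc (Measure.pi fun _ : Λ => haarProbability H) r (hhm.comp (hconsm u))
      (fun W => hhb _)
  simp only [hsnoc]
  -- the chain's end points and interior
  have hprod : ∀ (u v : Λ → H) (x : Fin r → Λ → H),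
      ∏ i, a ((Fin.cons u (Fin.snoc x v) : Fin (r + 2) → Λ → H) i) ^ 2 = a u ^ 2 * a v ^ 2 * ∏ k, a (x k) ^ 2 := by
    intro u v x
    rw [← sq_mul_sq_mul_prod_eq r (fun V => a V ^ 2) (Fin.cons u (Fin.snoc x v))]
    simp only [Fin.cons_zero, consSnoc_last, consSnoc_castSucc_succ]
  simp only [Fin.cons_zero, consSnoc_last, hprod]
  have hBk := blockKernel_eq_integral_core src tgt w a hw hw0 hwC ha haC M r hFm hFb
  have hKav : ∀ v, sandKernel src tgt w a (ctwist z⁻¹ v) q = a v * avgKernel src tgt w v (ctwist z q) * a q := by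
    intro v
    rw [sandKernel, haT, ← avgKernel_ctwist src tgt w hz (ctwist z⁻¹ v) q, ctwist_ctwist_inv]
  simp only [hBk, hKav]
  rw [← integral_const_mul, ← integral_mul_const]
  refine integral_congr_ae (Eventually.of_forall fun u => ?_)
  dsimp only
  have hx : ∀ v : Λ → H, ∫ x : Fin r → Λ → H, avgKernel src tgt w p u *
        (avgKernel src tgt w v (ctwist z q) * (a u ^ 2 * a v ^ 2 * (∏ k, a (x k) ^ 2) *
          core src tgt w M r F (Fin.cons u (Fin.snoc x v))))
        ∂(Measure.pi fun _ => Measure.pi fun _ : Λ => haarProbability H) =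
      (avgKernel src tgt w p u * avgKernel src tgt w v (ctwist z q) * (a u ^ 2 * a v ^ 2)) *
        ∫ x : Fin r → Λ → H, (∏ k, a (x k) ^ 2) * core src tgt w M r F (Fin.cons u (Fin.snoc x v))
          ∂(Measure.pi fun _ => Measure.pi fun _ : Λ => haarProbability H) := by
    intro v
    rw [← integral_const_mul]
    refine integral_congr_ae (Eventually.of_forall fun x => ?_)
    dsimp only
    ring
  simp only [hx]
  rw [sandKernel, ← integral_const_mul, ← integral_mul_const, ← integral_const_mul]
  refine integral_congr_ae (Eventually.of_forall fun v => ?_)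
  dsimp only
  ring


/-! ### Stage B + D: the temporal transfer-operator form of a windowed section -/

set_option maxHeartbeats 400000 in
/-- **Layers ↦ block chain** (the abstract heart of the located stub `L`).  The joint slice/layer integral of
`F · ∏ₜ Mg(Vₜ) · ∏ₜ tempKernel(Vₜ, Eₜ, seam • V_{t+1})` — species `F` reading only the block (slices
`natAdd i`, layers `natAdd b.castSucc`), seam `z` on the layer after the block, `Mg = a²` — equals the cyclic
`sandKernel`-chain of length `M + 3` with ONE bond replaced by the insertion `∫∫ K(V₀,u) Bk(u,v) K(z⁻¹ • v, V₁)`,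
`Bk = blockKernel`.  Stage A integrates the layers out, Stage B is Fubini + the splitting of the slices into
(outer, block), Stage C (`block_inner`) re-sandwiches the block, Stage D relabels the outer cycle by
`(finRotate (M+3)).symm`. -/
theorem integral_layers_eq_blockChain (hw : Continuous w) (hw0 : ∀ h, 0 ≤ w h) {Cw : ℝ} (hwC : ∀ h, w h ≤ Cw)
    (ha : Measurable a) {Ca : ℝ} (haC : ∀ V, |a V| ≤ Ca) {Mg : (Λ → H) → ℝ} (hMg : ∀ V, Mg V = a V ^ 2)
    {z : Λ → H} (hz : ∀ l, z l ∈ Subgroup.center H) (haT : ∀ V, a (ctwist z⁻¹ V) = a V) (M r : ℕ)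
    {F : (Fin ((M + 3) + (r + 2)) → Λ → H) × (Fin ((M + 3) + (r + 2)) → P → H) → ℝ} (hFm : Measurable F)
    {nrm : ℝ} (hFb : ∀ q, |F q| ≤ nrm)
    (hFdep : ∀ q q' : (Fin ((M + 3) + (r + 2)) → Λ → H) × (Fin ((M + 3) + (r + 2)) → P → H),
      (∀ i, q.1 (Fin.natAdd (M + 3) i) = q'.1 (Fin.natAdd (M + 3) i)) →
      (∀ b : Fin (r + 1), q.2 (Fin.natAdd (M + 3) (Fin.castSucc b)) = q'.2 (Fin.natAdd (M + 3) (Fin.castSucc b))) →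
        F q = F q')
    {sm : Fin ((M + 3) + (r + 2)) → Λ → H} (hsm₁ : sm (Fin.natAdd (M + 3) (Fin.last (r + 1))) = z)
    (hsm₀ : ∀ t, t ≠ Fin.natAdd (M + 3) (Fin.last (r + 1)) → sm t = 1) :
    ∫ q : (Fin ((M + 3) + (r + 2)) → Λ → H) × (Fin ((M + 3) + (r + 2)) → P → H),
        F q * ((∏ t, Mg (q.1 t)) *
          ∏ t, tempKernel src tgt w (q.1 t) (q.2 t) (ctwist (sm t) (q.1 (finRotate _ t))))
      ∂((Measure.pi fun _ => Measure.pi fun _ : Λ => haarProbability H).prod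
          (Measure.pi fun _ => Measure.pi fun _ : P => haarProbability H)) =
    ∫ V : Fin (M + 3) → Λ → H,
        (∫ u, sandKernel src tgt w a (V 0) u *
            ∫ v, blockKernel src tgt w a M r F u v * sandKernel src tgt w a (ctwist z⁻¹ v) (V 1)
            ∂(Measure.pi fun _ : Λ => haarProbability H) ∂(Measure.pi fun _ : Λ => haarProbability H)) *
          ∏ t : Fin (M + 2), sandKernel src tgt w a (V t.succ) (V (t.succ + 1))
      ∂(Measure.pi fun _ => Measure.pi fun _ : Λ => haarProbability H) := by
  simp only [hMg]
  /- (B1) Fubini over (slices, layers) -/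
  have hsmm : ∀ t, Measurable (ctwist (sm t) : (Λ → H) → Λ → H) := fun t => (continuous_ctwist (sm t)).measurable
  have hq1 : ∀ t, Measurable fun q : (Fin ((M + 3) + (r + 2)) → Λ → H) × (Fin ((M + 3) + (r + 2)) → P → H) => q.1 t :=
    fun t => (measurable_pi_apply t).comp measurable_fst
  have hq2 : ∀ t, Measurable fun q : (Fin ((M + 3) + (r + 2)) → Λ → H) × (Fin ((M + 3) + (r + 2)) → P → H) => q.2 t :=
    fun t => (measurable_pi_apply t).comp measurable_snd
  have hΨm : Measurable fun q : (Fin ((M + 3) + (r + 2)) → Λ → H) × (Fin ((M + 3) + (r + 2)) → P → H) =>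
      F q * ((∏ t, a (q.1 t) ^ 2) *
        ∏ t, tempKernel src tgt w (q.1 t) (q.2 t) (ctwist (sm t) (q.1 (finRotate _ t)))) :=
    hFm.mul ((Finset.measurable_prod _ fun t _ => (ha.comp (hq1 t)).pow_const 2).mul
      (Finset.measurable_prod _ fun t _ => measurable_tempKernel_comp₃ src tgt w hw (hq1 t) (hq2 t)
        ((hsmm t).comp (hq1 (finRotate _ t)))))
  have hΨb : ∀ q : (Fin ((M + 3) + (r + 2)) → Λ → H) × (Fin ((M + 3) + (r + 2)) → P → H),
      ‖F q * ((∏ t, a (q.1 t) ^ 2) *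
        ∏ t, tempKernel src tgt w (q.1 t) (q.2 t) (ctwist (sm t) (q.1 (finRotate _ t))))‖ ≤
        nrm * ((Ca ^ 2) ^ ((M + 3) + (r + 2)) * (Cw ^ Fintype.card Λ) ^ ((M + 3) + (r + 2))) := by
    intro q
    rw [Real.norm_eq_abs]
    refine abs_mul_le_mul (hFb q) (abs_mul_le_mul (abs_prod_sq_le a haC q.1) ?_)
    have h := abs_prod_tempKernel_le src tgt w hw0 hwC q.1 (fun t => ctwist (sm t) (q.1 (finRotate _ t))) q.2
    rwa [Fintype.card_fin] at h
  have hint : Integrable (fun q : (Fin ((M + 3) + (r + 2)) → Λ → H) × (Fin ((M + 3) + (r + 2)) → P → H) =>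
      F q * ((∏ t, a (q.1 t) ^ 2) *
        ∏ t, tempKernel src tgt w (q.1 t) (q.2 t) (ctwist (sm t) (q.1 (finRotate _ t)))))
      ((Measure.pi fun _ => Measure.pi fun _ : Λ => haarProbability H).prod
        (Measure.pi fun _ => Measure.pi fun _ : P => haarProbability H)) :=
    (integrable_const _).mono' hΨm.aestronglyMeasurable (Eventually.of_forall hΨb)
  rw [integral_prod _ hint]
  /- (B2) at fixed slices: constants out, layers by Stage A, read through the splitting of the slices -/
  have hV : ∀ V : Fin ((M + 3) + (r + 2)) → Λ → H,
      ∫ E : Fin ((M + 3) + (r + 2)) → P → H, F (V, E) * ((∏ t, a (V t) ^ 2) *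
          ∏ t, tempKernel src tgt w (V t) (E t) (ctwist (sm t) (V (finRotate _ t))))
        ∂(Measure.pi fun _ => Measure.pi fun _ : P => haarProbability H) =
      (fun pV : (Fin (M + 3) → Λ → H) × (Fin (r + 2) → Λ → H) =>
        ((∏ j, a (pV.1 j) ^ 2) * ∏ j : Fin (M + 2), avgKernel src tgt w (pV.1 (Fin.castSucc j)) (pV.1 j.succ)) *
          (avgKernel src tgt w (pV.1 (Fin.last (M + 2))) (pV.2 0) *
            (avgKernel src tgt w (pV.2 (Fin.last (r + 1))) (ctwist z (pV.1 0)) *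
              ((∏ i, a (pV.2 i) ^ 2) * core src tgt w M r F pV.2))))
        (finSplit (Λ → H) (M + 3) (r + 2) V) := by
    intro V
    have h1 : ∫ E : Fin ((M + 3) + (r + 2)) → P → H, F (V, E) * ((∏ t, a (V t) ^ 2) *
          ∏ t, tempKernel src tgt w (V t) (E t) (ctwist (sm t) (V (finRotate _ t))))
        ∂(Measure.pi fun _ => Measure.pi fun _ : P => haarProbability H) =
        (∏ t, a (V t) ^ 2) * ∫ E : Fin ((M + 3) + (r + 2)) → P → H, F (V, E) *
          ∏ t, tempKernel src tgt w (V t) (E t) (ctwist (sm t) (V (finRotate _ t)))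
        ∂(Measure.pi fun _ => Measure.pi fun _ : P => haarProbability H) := by
      rw [← integral_const_mul]
      refine integral_congr_ae (Eventually.of_forall fun E => ?_)
      dsimp only
      ring
    rw [h1, integral_layers_fixedSlices src tgt w M r hFdep hsm₁ hsm₀ V,
      integral_blockLayers_eq_core src tgt w M r hFdep V, Fin.prod_univ_add]
    simp only [finSplit_fst, finSplit_snd]
    ring
  /- (B3) transport to (outer slices, block slices); integrability there -/
  have heV : MeasurePreserving (finSplit (Λ → H) (M + 3) (r + 2))
      (Measure.pi fun _ => Measure.pi fun _ : Λ => haarProbability H)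
      ((Measure.pi fun _ : Fin (M + 3) => Measure.pi fun _ : Λ => haarProbability H).prod
        (Measure.pi fun _ : Fin (r + 2) => Measure.pi fun _ : Λ => haarProbability H)) :=
    measurePreserving_finSplit' _ (M + 3) (r + 2)
  have hp1 : ∀ j, Measurable fun pV : (Fin (M + 3) → Λ → H) × (Fin (r + 2) → Λ → H) => pV.1 j :=
    fun j => (measurable_pi_apply j).comp measurable_fst
  have hp2 : ∀ i, Measurable fun pV : (Fin (M + 3) → Λ → H) × (Fin (r + 2) → Λ → H) => pV.2 i :=
    fun i => (measurable_pi_apply i).comp measurable_snd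
  have hcz : Measurable fun pV : (Fin (M + 3) → Λ → H) × (Fin (r + 2) → Λ → H) => ctwist z (pV.1 0) :=
    (continuous_ctwist z).measurable.comp (hp1 0)
  have hcore2 : Measurable fun pV : (Fin (M + 3) → Λ → H) × (Fin (r + 2) → Λ → H) => core src tgt w M r F pV.2 :=
    (measurable_core src tgt w hw M r hFm).comp measurable_snd
  have hGm : Measurable fun pV : (Fin (M + 3) → Λ → H) × (Fin (r + 2) → Λ → H) =>
      ((∏ j, a (pV.1 j) ^ 2) * ∏ j : Fin (M + 2), avgKernel src tgt w (pV.1 (Fin.castSucc j)) (pV.1 j.succ)) *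
          (avgKernel src tgt w (pV.1 (Fin.last (M + 2))) (pV.2 0) *
            (avgKernel src tgt w (pV.2 (Fin.last (r + 1))) (ctwist z (pV.1 0)) *
              ((∏ i, a (pV.2 i) ^ 2) * core src tgt w M r F pV.2))) :=
    ((Finset.measurable_prod _ fun j _ => (ha.comp (hp1 j)).pow_const 2).mul
      (Finset.measurable_prod _ fun j _ =>
        measurable_avgKernel_comp₂ src tgt w hw (hp1 (Fin.castSucc j)) (hp1 j.succ))).mul
      ((measurable_avgKernel_comp₂ src tgt w hw (hp1 (Fin.last (M + 2))) (hp2 0)).mul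
        ((measurable_avgKernel_comp₂ src tgt w hw (hp2 (Fin.last (r + 1))) hcz).mul
          ((Finset.measurable_prod _ fun i _ => (ha.comp (hp2 i)).pow_const 2).mul hcore2)))
  have hGb : ∀ pV : (Fin (M + 3) → Λ → H) × (Fin (r + 2) → Λ → H),
      ‖((∏ j, a (pV.1 j) ^ 2) * ∏ j : Fin (M + 2), avgKernel src tgt w (pV.1 (Fin.castSucc j)) (pV.1 j.succ)) *
          (avgKernel src tgt w (pV.1 (Fin.last (M + 2))) (pV.2 0) *
            (avgKernel src tgt w (pV.2 (Fin.last (r + 1))) (ctwist z (pV.1 0)) *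
              ((∏ i, a (pV.2 i) ^ 2) * core src tgt w M r F pV.2)))‖ ≤
      ((Ca ^ 2) ^ (M + 3) * (Cw ^ Fintype.card Λ) ^ (M + 2)) * (Cw ^ Fintype.card Λ * (Cw ^ Fintype.card Λ *
        ((Ca ^ 2) ^ (r + 2) * (nrm * (Cw ^ Fintype.card Λ) ^ (r + 1))))) := by
    intro pV
    rw [Real.norm_eq_abs]
    refine abs_mul_le_mul (abs_mul_le_mul (abs_prod_sq_le a haC pV.1)
      (abs_prod_avgKernel_le src tgt w hw0 hwC (fun j => pV.1 (Fin.castSucc j)) (fun j => pV.1 j.succ)))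
      (abs_mul_le_mul (abs_avgKernel_le src tgt w hw0 hwC _ _)
        (abs_mul_le_mul (abs_avgKernel_le src tgt w hw0 hwC _ _)
          (abs_mul_le_mul (abs_prod_sq_le a haC pV.2) ?_)))
    rw [← Real.norm_eq_abs]; exact norm_core_le src tgt w hw0 hwC M r hFb pV.2
  have hGint : Integrable (fun pV : (Fin (M + 3) → Λ → H) × (Fin (r + 2) → Λ → H) =>
      ((∏ j, a (pV.1 j) ^ 2) * ∏ j : Fin (M + 2), avgKernel src tgt w (pV.1 (Fin.castSucc j)) (pV.1 j.succ)) *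
          (avgKernel src tgt w (pV.1 (Fin.last (M + 2))) (pV.2 0) *
            (avgKernel src tgt w (pV.2 (Fin.last (r + 1))) (ctwist z (pV.1 0)) *
              ((∏ i, a (pV.2 i) ^ 2) * core src tgt w M r F pV.2))))
      ((Measure.pi fun _ : Fin (M + 3) => Measure.pi fun _ : Λ => haarProbability H).prod
        (Measure.pi fun _ : Fin (r + 2) => Measure.pi fun _ : Λ => haarProbability H)) :=
    (integrable_const _).mono' hGm.aestronglyMeasurable (Eventually.of_forall hGb)
  /- (D) the outer cycle relabelled by `(finRotate (M + 3)).symm` -/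
  have s0 : (finRotate (M + 3)).symm 0 = Fin.last (M + 2) := by
    rw [Equiv.symm_apply_eq]; exact finRotate_last.symm
  have s1 : (finRotate (M + 3)).symm 1 = 0 := by
    rw [Equiv.symm_apply_eq, finRotate_apply, zero_add]
  have s2 : ∀ t : Fin (M + 2), (finRotate (M + 3)).symm t.succ = Fin.castSucc t := fun t => by
    rw [Equiv.symm_apply_eq, finRotate_apply, Fin.coeSucc_eq_succ]
  have s3 : ∀ t : Fin (M + 2), (finRotate (M + 3)).symm (t.succ + 1) = t.succ := fun t => by
    rw [Equiv.symm_apply_eq, finRotate_apply]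
  calc ∫ V : Fin ((M + 3) + (r + 2)) → Λ → H, ∫ E : Fin ((M + 3) + (r + 2)) → P → H,
          (fun q : (Fin ((M + 3) + (r + 2)) → Λ → H) × (Fin ((M + 3) + (r + 2)) → P → H) =>
            F q * ((∏ t, a (q.1 t) ^ 2) *
              ∏ t, tempKernel src tgt w (q.1 t) (q.2 t) (ctwist (sm t) (q.1 (finRotate _ t))))) (V, E)
          ∂(Measure.pi fun _ => Measure.pi fun _ : P => haarProbability H)
        ∂(Measure.pi fun _ => Measure.pi fun _ : Λ => haarProbability H)
      = ∫ V : Fin ((M + 3) + (r + 2)) → Λ → H, (fun pV : (Fin (M + 3) → Λ → H) × (Fin (r + 2) → Λ → H) =>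
          ((∏ j, a (pV.1 j) ^ 2) * ∏ j : Fin (M + 2), avgKernel src tgt w (pV.1 (Fin.castSucc j)) (pV.1 j.succ)) *
          (avgKernel src tgt w (pV.1 (Fin.last (M + 2))) (pV.2 0) *
            (avgKernel src tgt w (pV.2 (Fin.last (r + 1))) (ctwist z (pV.1 0)) *
              ((∏ i, a (pV.2 i) ^ 2) * core src tgt w M r F pV.2))))
          (finSplit (Λ → H) (M + 3) (r + 2) V) ∂(Measure.pi fun _ => Measure.pi fun _ : Λ => haarProbability H) := by
        refine integral_congr_ae (Eventually.of_forall fun V => ?_)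
        dsimp only
        exact hV V
    _ = ∫ pV : (Fin (M + 3) → Λ → H) × (Fin (r + 2) → Λ → H),
          ((∏ j, a (pV.1 j) ^ 2) * ∏ j : Fin (M + 2), avgKernel src tgt w (pV.1 (Fin.castSucc j)) (pV.1 j.succ)) *
          (avgKernel src tgt w (pV.1 (Fin.last (M + 2))) (pV.2 0) *
            (avgKernel src tgt w (pV.2 (Fin.last (r + 1))) (ctwist z (pV.1 0)) *
              ((∏ i, a (pV.2 i) ^ 2) * core src tgt w M r F pV.2)))
        ∂((Measure.pi fun _ : Fin (M + 3) => Measure.pi fun _ : Λ => haarProbability H).prod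
          (Measure.pi fun _ : Fin (r + 2) => Measure.pi fun _ : Λ => haarProbability H)) :=
        heV.integral_comp' (fun pV : (Fin (M + 3) → Λ → H) × (Fin (r + 2) → Λ → H) =>
          ((∏ j, a (pV.1 j) ^ 2) * ∏ j : Fin (M + 2), avgKernel src tgt w (pV.1 (Fin.castSucc j)) (pV.1 j.succ)) *
          (avgKernel src tgt w (pV.1 (Fin.last (M + 2))) (pV.2 0) *
            (avgKernel src tgt w (pV.2 (Fin.last (r + 1))) (ctwist z (pV.1 0)) *
              ((∏ i, a (pV.2 i) ^ 2) * core src tgt w M r F pV.2))))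
    _ = ∫ Vo : Fin (M + 3) → Λ → H, ∫ Vb : Fin (r + 2) → Λ → H, (fun pV : (Fin (M + 3) → Λ → H) × (Fin (r + 2) → Λ → H) =>
          ((∏ j, a (pV.1 j) ^ 2) * ∏ j : Fin (M + 2), avgKernel src tgt w (pV.1 (Fin.castSucc j)) (pV.1 j.succ)) *
          (avgKernel src tgt w (pV.1 (Fin.last (M + 2))) (pV.2 0) *
            (avgKernel src tgt w (pV.2 (Fin.last (r + 1))) (ctwist z (pV.1 0)) *
              ((∏ i, a (pV.2 i) ^ 2) * core src tgt w M r F pV.2)))) (Vo, Vb)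
          ∂(Measure.pi fun _ : Fin (r + 2) => Measure.pi fun _ : Λ => haarProbability H)
        ∂(Measure.pi fun _ : Fin (M + 3) => Measure.pi fun _ : Λ => haarProbability H) := integral_prod _ hGint
    _ = ∫ Vo : Fin (M + 3) → Λ → H,
          (∫ u, sandKernel src tgt w a (Vo (Fin.last (M + 2))) u *
            ∫ v, blockKernel src tgt w a M r F u v * sandKernel src tgt w a (ctwist z⁻¹ v) (Vo 0)
            ∂(Measure.pi fun _ : Λ => haarProbability H) ∂(Measure.pi fun _ : Λ => haarProbability H)) *
          ∏ j : Fin (M + 2), sandKernel src tgt w a (Vo (Fin.castSucc j)) (Vo j.succ)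
        ∂(Measure.pi fun _ : Fin (M + 3) => Measure.pi fun _ : Λ => haarProbability H) := by
        refine integral_congr_ae (Eventually.of_forall fun Vo => ?_)
        dsimp only
        rw [integral_const_mul, ← block_inner src tgt w a hw hw0 hwC ha haC hz haT M r hFm hFb
          (Vo (Fin.last (M + 2))) (Vo 0)]
        have hsq : ∏ j : Fin (M + 3), a (Vo j) ^ 2 =
            a (Vo (Fin.last (M + 2))) * a (Vo 0) * ∏ j : Fin (M + 2), (a (Vo (Fin.castSucc j)) * a (Vo j.succ)) :=
          (prod_castSucc_mul_succ_eq_prod_sq (M + 1) (fun j => a (Vo j))).symm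
        rw [hsq]
        simp only [sandKernel, Finset.prod_mul_distrib]
        ring
    _ = ∫ V : Fin (M + 3) → Λ → H,
        (∫ u, sandKernel src tgt w a (V 0) u *
            ∫ v, blockKernel src tgt w a M r F u v * sandKernel src tgt w a (ctwist z⁻¹ v) (V 1)
            ∂(Measure.pi fun _ : Λ => haarProbability H) ∂(Measure.pi fun _ : Λ => haarProbability H)) *
          ∏ t : Fin (M + 2), sandKernel src tgt w a (V t.succ) (V (t.succ + 1))
      ∂(Measure.pi fun _ => Measure.pi fun _ : Λ => haarProbability H) := by
        rw [← Literature.Analysis.OperatorTheory.integral_pi_comp_perm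
          (ρ := Measure.pi fun _ : Λ => haarProbability H) (finRotate (M + 3)).symm
          (fun V : Fin (M + 3) → Λ → H =>
            (∫ u, sandKernel src tgt w a (V 0) u *
            ∫ v, blockKernel src tgt w a M r F u v * sandKernel src tgt w a (ctwist z⁻¹ v) (V 1)
            ∂(Measure.pi fun _ : Λ => haarProbability H) ∂(Measure.pi fun _ : Λ => haarProbability H)) *
          ∏ t : Fin (M + 2), sandKernel src tgt w a (V t.succ) (V (t.succ + 1)))]
        refine integral_congr_ae (Eventually.of_forall fun Vo => ?_)
        dsimp only
        simp only [s0, s1, s2, s3]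

end BlockChain

/-! ## PART 4 — the relabelling, the window of a species, and the located stub L -/

/-! ### The cyclic relabelling of the time axis -/

section Relabel

/-- **The cyclic relabelling** `t ↦ cast t + c` of a time axis of length `m' = m` by a rotation `c`. -/
def relabel {m' m : ℕ} [NeZero m] (h : m' = m) (c : Fin m) : Fin m' ≃ Fin m :=
  (finCongr h).trans (Equiv.addRight c)

theorem val_relabel {m' m : ℕ} [NeZero m] (h : m' = m) (c : Fin m) (t : Fin m') :
    ((relabel h c t : Fin m) : ℕ) = ((t : ℕ) + c) % m := by
  subst h; rfl

/-- The relabelling commutes with the cyclic shifts. -/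
theorem relabel_finRotate {m' m : ℕ} [NeZero m] (h : m' = m) (c : Fin m) (t : Fin m') :
    relabel h c (finRotate m' t) = finRotate m (relabel h c t) := by
  subst h
  apply Fin.ext
  rw [val_relabel, val_finRotate, val_finRotate, val_relabel, Nat.mod_add_mod, Nat.mod_add_mod,
    Nat.add_right_comm]

/-- **Relabelling the time axis of a joint slice∕layer integral** along any `σ : Fin m' ≃ Fin m`
(`measurePreserving_piCongrLeft` on both factors). -/
theorem integral_comp_relabel {Y Z : Type*} [MeasurableSpace Y] [MeasurableSpace Z] (μ : Measure Y) (ν : Measure Z)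
    [SigmaFinite μ] [SigmaFinite ν] {m m' : ℕ} (σ : Fin m' ≃ Fin m) (Φ : (Fin m → Y) × (Fin m → Z) → ℝ) :
    ∫ q : (Fin m' → Y) × (Fin m' → Z), Φ (fun t => q.1 (σ.symm t), fun t => q.2 (σ.symm t))
        ∂((Measure.pi fun _ : Fin m' => μ).prod (Measure.pi fun _ : Fin m' => ν)) =
      ∫ q, Φ q ∂((Measure.pi fun _ : Fin m => μ).prod (Measure.pi fun _ : Fin m => ν)) := by
  have h1 : MeasurePreserving (MeasurableEquiv.piCongrLeft (fun _ : Fin m' => Y) σ.symm).symm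
      (Measure.pi fun _ : Fin m' => μ) (Measure.pi fun _ : Fin m => μ) :=
    (measurePreserving_piCongrLeft (fun _ : Fin m' => μ) σ.symm).symm _
  have h2 : MeasurePreserving (MeasurableEquiv.piCongrLeft (fun _ : Fin m' => Z) σ.symm).symm
      (Measure.pi fun _ : Fin m' => ν) (Measure.pi fun _ : Fin m => ν) :=
    (measurePreserving_piCongrLeft (fun _ : Fin m' => ν) σ.symm).symm _
  exact (h1.prod h2).integral_comp
    ((MeasurableEquiv.piCongrLeft (fun _ : Fin m' => Y) σ.symm).symm.measurableEmbedding.prodMap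
      (MeasurableEquiv.piCongrLeft (fun _ : Fin m' => Z) σ.symm).symm.measurableEmbedding) Φ

/-- Products over a relabelled time axis. -/
theorem prod_comp_relabel {m m' : ℕ} (σ : Fin m' ≃ Fin m) (f : Fin m → ℝ) : ∏ t', f (σ t') = ∏ t, f t :=
  Fintype.prod_equiv σ _ _ fun _ => rfl

/-- `ZMod.finEquiv` preserves the residue. -/
theorem val_finEquiv_symm (L : ℕ) [NeZero L] (x : ZMod L) : (((ZMod.finEquiv L).symm x : Fin L) : ℕ) = x.val := by
  cases L with
  | zero => exact (NeZero.ne 0 rfl).elim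
  | succ n => rfl

/-- The rotation amount putting the block of the layout `Fin ((M + 3) + (r + 2))` onto the time window starting at
`t₀ (mod L)`: `c ≡ t₀ − (M + 3) (mod L)`. -/
def rotAmt (L : ℕ) [NeZero L] (t₀ : ℤ) (M : ℕ) : Fin L :=
  ⟨((t₀ - ((M : ℤ) + 3)) % (L : ℤ)).toNat, by
    have hL : (0 : ℤ) < L := by exact_mod_cast Nat.pos_of_ne_zero (NeZero.ne L)
    have h0 := Int.emod_nonneg (t₀ - ((M : ℤ) + 3)) hL.ne'
    have h1 := Int.emod_lt_of_pos (t₀ - ((M : ℤ) + 3)) hL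
    generalize (t₀ - ((M : ℤ) + 3)) % (L : ℤ) = y at h0 h1
    omega⟩

/-- **The block hits the window**: with `c = rotAmt L t₀ M`, the block slice `natAdd (M+3) b` of the layout is relabelled to
the time `t₀ + b (mod L)`, i.e. to the `zCoord`-time of any edge whose first coordinate is `t₀ + b`. -/
theorem relabel_natAdd_eq {L M r : ℕ} [NeZero L] (h : (M + 3) + (r + 2) = L) (t₀ : ℤ) (b : Fin (r + 2)) (x : ℤ)
    (hx : x = t₀ + b) :
    relabel h (rotAmt L t₀ M) (Fin.natAdd (M + 3) b) = (ZMod.finEquiv L).symm ((x : ℤ) : ZMod L) := by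
  apply Fin.ext
  rw [val_finEquiv_symm, val_relabel, Fin.val_natAdd]
  have hL0 : (L : ℤ) ≠ 0 := by exact_mod_cast NeZero.ne L
  have e2 : ((((t₀ - ((M : ℤ) + 3)) % (L : ℤ)).toNat : ℕ) : ℤ) = (t₀ - ((M : ℤ) + 3)) % (L : ℤ) :=
    Int.toNat_of_nonneg (Int.emod_nonneg _ hL0)
  refine Int.natCast_inj.mp ?_
  rw [ZMod.val_intCast, hx]
  push_cast
  rw [rotAmt, Fin.val_mk, e2]
  have hme : ((M : ℤ) + 3 + (b : ℕ) + (t₀ - ((M : ℤ) + 3)) % (L : ℤ)) ≡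
      ((M : ℤ) + 3 + (b : ℕ) + (t₀ - ((M : ℤ) + 3))) [ZMOD (L : ℤ)] :=
    (Int.mod_modEq _ _).add_left _
  rw [Int.ModEq] at hme
  rw [hme]
  congr 1
  ring

end Relabel

/-! ### The temporal window of a species and its size -/

section SpeciesData

open Literature.MathematicalPhysics.QuantumFieldTheory Literature.MathematicalPhysics.QuantumLattice

variable {G : Type} [Group G] [MeasurableSpace G]

/-- The time coordinates (first `ℤ⁴`-coordinate of the base point) of the support edges of a species. -/
def times (A : YMSpecies G) : Finset ℤ := A.supp.image fun d => d.1 0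

/-- First time of the support window of a species (`0` for an empty support). -/
def tLo (A : YMSpecies G) : ℤ := if h : (times A).Nonempty then (times A).min' h else 0

/-- Last time of the support window of a species (`0` for an empty support). -/
def tHi (A : YMSpecies G) : ℤ := if h : (times A).Nonempty then (times A).max' h else 0

theorem tLo_le (A : YMSpecies G) {d : Literature.MathematicalPhysics.QuantumLattice.ZdEdge 4} (hd : d ∈ A.supp) : tLo A ≤ d.1 0 := by
  have hm : d.1 0 ∈ times A := Finset.mem_image.mpr ⟨d, hd, rfl⟩
  rw [tLo, dif_pos ⟨_, hm⟩]
  exact Finset.min'_le _ _ hm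

theorem le_tHi (A : YMSpecies G) {d : Literature.MathematicalPhysics.QuantumLattice.ZdEdge 4} (hd : d ∈ A.supp) : d.1 0 ≤ tHi A := by
  have hm : d.1 0 ∈ times A := Finset.mem_image.mpr ⟨d, hd, rfl⟩
  rw [tHi, dif_pos ⟨_, hm⟩]
  exact Finset.le_max' _ _ hm

theorem tLo_le_tHi (A : YMSpecies G) : tLo A ≤ tHi A := by
  unfold tLo tHi
  split_ifs with h
  · exact Finset.min'_le _ _ (Finset.max'_mem _ h)
  · exact le_rfl

/-- **Temporal THICKNESS** of a species: the number of consecutive time slices spanned by its support window (`≥ 1`). -/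
def thick (A : YMSpecies G) : ℕ := (tHi A - tLo A).toNat + 1

theorem one_le_thick (A : YMSpecies G) : 1 ≤ thick A := Nat.le_add_left 1 _

/-- **SIZE** of a species: a nonnegative uniform bound of `A.F`. -/
def nrm (A : YMSpecies G) : ℝ := max (Classical.choose A.bounded) 0

theorem abs_le_nrm (A : YMSpecies G) (U : LGConfig 4 G) : |A.F U| ≤ nrm A :=
  (Classical.choose_spec A.bounded U).trans (le_max_left _ _)

theorem nrm_nonneg (A : YMSpecies G) : 0 ≤ nrm A := le_max_right _ _

end SpeciesData

/-! ### The species in the block layout -/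

section Layout

open Literature.MathematicalPhysics.QuantumFieldTheory Literature.MathematicalPhysics.QuantumLattice
open Literature.MathematicalPhysics.QuantumLattice (torusLift torusEdge)

variable {G H : Type} [Group G] [MeasurableSpace G] [Group H] [MeasurableSpace H] (π : H →* G)

/-- **The pulled-back species in the block layout**: `Ã(assembleZero ·)` read through a relabelling `σ` of the time axis. -/
def speciesL5 {L m' : ℕ} [NeZero L] (A : YMSpecies G) (σ : Fin m' ≃ Fin L)
    (q : (Fin m' → (FinSpatialSite L L L × Fin 3 → H)) × (Fin m' → (FinSpatialSite L L L → H))) : ℝ :=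
  A.F (fun d => π (torusLift L ((finTorusConfigEquivSite H L).symm
    (assembleZero ((fun t => q.1 (σ.symm t), fun t => q.2 (σ.symm t)) :
      (Fin L → (FinSpatialSite L L L × Fin 3 → H)) × (Fin L → (FinSpatialSite L L L → H))))) d))

theorem abs_speciesL5_le {L m' : ℕ} [NeZero L] (A : YMSpecies G) (σ : Fin m' ≃ Fin L)
    (q : (Fin m' → (FinSpatialSite L L L × Fin 3 → H)) × (Fin m' → (FinSpatialSite L L L → H))) :
    |speciesL5 π A σ q| ≤ nrm A :=
  abs_le_nrm A _

theorem measurable_speciesL5 [TopologicalSpace G] [BorelSpace G] [TopologicalSpace H] [BorelSpace H]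
    (hπ : Continuous π) {L m' : ℕ} [NeZero L] (A : YMSpecies G) (σ : Fin m' ≃ Fin L) :
    Measurable (speciesL5 π A σ :
      (Fin m' → (FinSpatialSite L L L × Fin 3 → H)) × (Fin m' → (FinSpatialSite L L L → H)) → ℝ) := by
  have hre : Measurable fun q : (Fin m' → (FinSpatialSite L L L × Fin 3 → H)) × (Fin m' → (FinSpatialSite L L L → H)) =>
      ((fun t => q.1 (σ.symm t), fun t => q.2 (σ.symm t)) :
        (Fin L → (FinSpatialSite L L L × Fin 3 → H)) × (Fin L → (FinSpatialSite L L L → H))) :=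
    (measurable_pi_lambda _ fun t => (measurable_pi_apply (σ.symm t)).comp measurable_fst).prodMk
      (measurable_pi_lambda _ fun t => (measurable_pi_apply (σ.symm t)).comp measurable_snd)
  refine A.measurable.comp (measurable_pi_lambda _ fun d => hπ.measurable.comp ?_)
  exact (measurable_pi_apply _).comp ((finTorusConfigEquivSite H L).symm.measurable.comp
    (measurable_assembleZero.comp hre))

/-- **Window**: if every support edge of `A` has its `zCoord`-time among the relabelled block layers
`σ (natAdd (M+3) b.castSucc)`, the species in the block layout reads only the block slices and block layers. -/
theorem speciesL5_dep {L M r : ℕ} [NeZero L] (A : YMSpecies G) (σ : Fin ((M + 3) + (r + 2)) ≃ Fin L)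
    (hwin : ∀ d ∈ A.supp, ∃ b : Fin (r + 1), (zCoord L d).1 = σ (Fin.natAdd (M + 3) (Fin.castSucc b)))
    (q q' : (Fin ((M + 3) + (r + 2)) → (FinSpatialSite L L L × Fin 3 → H)) ×
      (Fin ((M + 3) + (r + 2)) → (FinSpatialSite L L L → H)))
    (h1 : ∀ i, q.1 (Fin.natAdd (M + 3) i) = q'.1 (Fin.natAdd (M + 3) i))
    (h2 : ∀ b : Fin (r + 1), q.2 (Fin.natAdd (M + 3) (Fin.castSucc b)) = q'.2 (Fin.natAdd (M + 3) (Fin.castSucc b))) :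
    speciesL5 π A σ q = speciesL5 π A σ q' := by
  unfold speciesL5
  refine pullback_assembleZero_congr π A fun d hd => ?_
  obtain ⟨b, hb⟩ := hwin d hd
  dsimp only
  rw [hb, Equiv.symm_apply_apply]
  exact ⟨h1 (Fin.castSucc b), h2 b⟩

/-- The window hypothesis for the relabelling `relabel h (rotAmt L (tLo A) M)` of a species of thickness `r + 1`. -/
theorem window_relabel {L M r : ℕ} [NeZero L] (A : YMSpecies G) (h : (M + 3) + (r + 2) = L) (hr : r + 1 = thick A)
    {d : Literature.MathematicalPhysics.QuantumLattice.ZdEdge 4} (hd : d ∈ A.supp) :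
    ∃ b : Fin (r + 1), (zCoord L d).1 = relabel h (rotAmt L (tLo A) M) (Fin.natAdd (M + 3) (Fin.castSucc b)) := by
  have h1 := tLo_le A hd
  have h2 := le_tHi A hd
  have hb : (d.1 0 - tLo A).toNat < r + 1 := by unfold thick at hr; omega
  refine ⟨⟨(d.1 0 - tLo A).toNat, hb⟩, ?_⟩
  have hz : (zCoord L d).1 = (ZMod.finEquiv L).symm ((d.1 0 : ℤ) : ZMod L) := by rw [zCoord_eq]
  rw [hz]
  refine (relabel_natAdd_eq h (tLo A) (Fin.castSucc ⟨(d.1 0 - tLo A).toNat, hb⟩) (d.1 0) ?_).symm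
  rw [Fin.val_castSucc, Fin.val_mk, Int.toNat_of_nonneg (by omega)]
  ring

end Layout

/-! ### The windowed section in block-chain form and the located stub L -/

section SecWBlock

open Literature.MathematicalPhysics.QuantumFieldTheory Literature.MathematicalPhysics.QuantumLattice
open Literature.MathematicalPhysics.QuantumLattice (torusLift torusEdge)
open Summit.QuantumFields.YangMills.Cruxes.IRcof.EquipartitionSeam.KernelCurrency (sectorTensor withEl secZ secW)

variable {G H : Type} [Group G] [TopologicalSpace G] [MeasurableSpace G] [BorelSpace G] [Group H] [TopologicalSpace H]
  [IsTopologicalGroup H] [CompactSpace H] [MeasurableSpace H] [BorelSpace H] [SecondCountableTopology H] (π : H →* G)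

set_option maxHeartbeats 400000 in
/-- **`W_{w,A}(withEl z₀ e)` AS A BLOCK CHAIN** — step (a) `secW_withEl_eq_integral_layers_seamAt` (seam parked on the layer
after the block) + the relabelling of the time axis along `σ` + the abstract steps (b)–(d) `integral_layers_eq_blockChain`. -/
theorem secW_withEl_eq_blockChain_of (w : H → ℝ) (hw : Continuous w) (hw0 : ∀ h, 0 ≤ w h) {Cw : ℝ} (hwC : ∀ h, w h ≤ Cw)
    (hcl : ∀ g h : H, w (g * h * g⁻¹) = w h) (hker : π.ker ≤ Subgroup.center H) (hπ : Continuous π) (z₀ : Sector π)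
    (S : ℕ) (A : YMSpecies G) (M r : ℕ) (σ : Fin ((M + 3) + (r + 2)) ≃ Fin (2 * S + 1))
    (hσ : ∀ t, σ (finRotate _ t) = finRotate _ (σ t))
    (hwin : ∀ d ∈ A.supp, ∃ b : Fin (r + 1), (zCoord (2 * S + 1) d).1 = σ (Fin.natAdd (M + 3) (Fin.castSucc b)))
    (e : Fin 3 → ↥π.ker) :
    secW π w (withEl π z₀ e) S A =
      ∫ V : Fin (M + 3) → (FinSpatialSite (2 * S + 1) (2 * S + 1) (2 * S + 1) × Fin 3 → H),
        (∫ u, sandKernel Prod.fst (fun l : FinSpatialSite (2 * S + 1) (2 * S + 1) (2 * S + 1) × Fin 3 => l.1.shift l.2) w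
              (fun V => Real.sqrt (magW π w z₀ V)) (V 0) u *
            ∫ v, blockKernel Prod.fst (fun l : FinSpatialSite (2 * S + 1) (2 * S + 1) (2 * S + 1) × Fin 3 => l.1.shift l.2)
                w (fun V => Real.sqrt (magW π w z₀ V)) M r (speciesL5 π A σ) u v *
              sandKernel Prod.fst (fun l : FinSpatialSite (2 * S + 1) (2 * S + 1) (2 * S + 1) × Fin 3 => l.1.shift l.2) w
                (fun V => Real.sqrt (magW π w z₀ V)) (ctwist (elTwist π e⁻¹) v) (V 1)
            ∂(Measure.pi fun _ : FinSpatialSite (2 * S + 1) (2 * S + 1) (2 * S + 1) × Fin 3 => haarProbability H)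
            ∂(Measure.pi fun _ : FinSpatialSite (2 * S + 1) (2 * S + 1) (2 * S + 1) × Fin 3 => haarProbability H)) *
          ∏ t : Fin (M + 2), sandKernel Prod.fst
            (fun l : FinSpatialSite (2 * S + 1) (2 * S + 1) (2 * S + 1) × Fin 3 => l.1.shift l.2) w
            (fun V => Real.sqrt (magW π w z₀ V)) (V t.succ) (V (t.succ + 1))
        ∂(Measure.pi fun _ => Measure.pi fun _ : FinSpatialSite (2 * S + 1) (2 * S + 1) (2 * S + 1) × Fin 3 =>
          haarProbability H) := by
  have hσ' : ∀ t, σ.symm (finRotate _ (σ t)) = finRotate _ t := fun t => by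
    rw [Equiv.symm_apply_eq, hσ]
  have haT : ∀ V : FinSpatialSite (2 * S + 1) (2 * S + 1) (2 * S + 1) × Fin 3 → H,
      (fun V => Real.sqrt (magW π w z₀ V)) (ctwist (elTwist π e)⁻¹ V) = (fun V => Real.sqrt (magW π w z₀ V)) V := by
    intro V
    dsimp only
    rw [← elTwist_inv]
    exact sqrt_magW_ctwist_elTwist π w hker z₀ e⁻¹ V
  have hsm₁ : (fun t => seamAt (σ (Fin.natAdd (M + 3) (Fin.last (r + 1)))) (elTwist π e) (σ t))
      (Fin.natAdd (M + 3) (Fin.last (r + 1))) =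
      (elTwist π e : FinSpatialSite (2 * S + 1) (2 * S + 1) (2 * S + 1) × Fin 3 → H) :=
    seamAt_self _ _
  have hsm₀ : ∀ t, t ≠ Fin.natAdd (M + 3) (Fin.last (r + 1)) →
      (fun t => seamAt (σ (Fin.natAdd (M + 3) (Fin.last (r + 1)))) (elTwist π e) (σ t)) t =
        (1 : FinSpatialSite (2 * S + 1) (2 * S + 1) (2 * S + 1) × Fin 3 → H) :=
    fun t ht => seamAt_of_ne _ fun h' => ht (σ.injective h')
  rw [secW_withEl_eq_integral_layers_seamAt π w hw hcl hker hπ z₀ e S A (σ (Fin.natAdd (M + 3) (Fin.last (r + 1)))),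
    elTwist_inv]
  refine Eq.trans ?_ (integral_layers_eq_blockChain Prod.fst
    (fun l : FinSpatialSite (2 * S + 1) (2 * S + 1) (2 * S + 1) × Fin 3 => l.1.shift l.2) w
    (fun V => Real.sqrt (magW π w z₀ V)) hw hw0 hwC (measurable_sqrt_magW π w hw z₀)
    (abs_sqrt_magW_le π w hw0 hwC z₀) (Mg := magW π w z₀) (fun V => (sq_sqrt_magW π w hw0 z₀ V).symm)
    (elTwist_mem_center π hker e) haT M r (measurable_speciesL5 π hπ A σ) (abs_speciesL5_le π A σ)
    (speciesL5_dep π A σ hwin) hsm₁ hsm₀)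
  refine ((integral_comp_relabel
    (Measure.pi fun _ : FinSpatialSite (2 * S + 1) (2 * S + 1) (2 * S + 1) × Fin 3 => haarProbability H)
    (Measure.pi fun _ : FinSpatialSite (2 * S + 1) (2 * S + 1) (2 * S + 1) => haarProbability H) σ _).symm).trans ?_
  refine integral_congr_ae (Eventually.of_forall fun q => ?_)
  dsimp only
  unfold speciesL5
  congr 1
  rw [← prod_comp_relabel σ (fun t => magW π w z₀ (q.1 (σ.symm t))),
    ← prod_comp_relabel σ (fun t => tempKernel Prod.fst
      (fun l : FinSpatialSite (2 * S + 1) (2 * S + 1) (2 * S + 1) × Fin 3 => l.1.shift l.2) w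
      (q.1 (σ.symm t)) (q.2 (σ.symm t))
      (ctwist (seamAt (σ (Fin.natAdd (M + 3) (Fin.last (r + 1)))) (elTwist π e) t) (q.1 (σ.symm (finRotate _ t)))))]
  simp only [Equiv.symm_apply_apply, hσ']

/-- **THE LOCATED STUB L — time-slice realisation of the split-weight sector functions — PROVED.**
Witnesses: `thick` ∕ `nrm` = temporal thickness ∕ size of a species, `β_D := 0`, `S_D := 0`; for each `z₀`:
`X :=` the spatial links of one time slice of the box `(2S+1)⁴`, `μ := ⊗Haar`, `K :=` the gauge-averaged slice kernel
sandwiched by `√magW` (`sandKernel`), `T e := ctwist (elTwist π e⁻¹)`; the (Z) side is `zPackage_of_twistSplitWeight` (+ the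
real → complex positive-type bridge `SpectralDict.complexPosType_of_real`), the (W) side is `blockKernel` of the species in the
block layout, `norm_blockKernel_le`, `abs_blockKernel_le_pathK` and `secW_withEl_eq_blockChain_of` along `relabel`. -/
theorem sliceRealisationV_holds : SpectralDict.SliceRealisationV := by
  intro G _ _ _ _ _ _ _ H _ _ _ _ _ _ _ _ π hπ _ hker _ _ ρH r c _
  haveI : SecondCountableTopology H :=
    (ρH.continuous.isClosedEmbedding ρH.injective).isEmbedding.secondCountableTopology
  refine ⟨thick, nrm, 0, fun _ => 0, fun A => ⟨one_le_thick A, nrm_nonneg A⟩, ?_⟩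
  intro β _ w hT S _ z₀
  have hw : Continuous w := hT.1
  have hw0 : ∀ h, 0 ≤ w h := hT.2.1
  have hcl : ∀ g h : H, w (g * h * g⁻¹) = w h := hT.2.2.2.1
  obtain ⟨h₀, -, hmax⟩ := isCompact_univ.exists_isMaxOn Set.univ_nonempty hw.continuousOn
  have hwC : ∀ h, w h ≤ w h₀ := fun h => hmax (Set.mem_univ h)
  obtain ⟨C, hP, hCG, hSM, hbd, hsym, hpos, hTμ, hT1, hTmul, hKT, hZ⟩ := zPackage_of_twistSplitWeight π hT hker z₀ S
  refine ⟨(FinSpatialSite (2 * S + 1) (2 * S + 1) (2 * S + 1) × Fin 3 → H), inferInstance,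
    Measure.pi fun _ : FinSpatialSite (2 * S + 1) (2 * S + 1) (2 * S + 1) × Fin 3 => haarProbability H,
    sandKernel Prod.fst (fun l : FinSpatialSite (2 * S + 1) (2 * S + 1) (2 * S + 1) × Fin 3 => l.1.shift l.2) w
      (fun V => Real.sqrt (magW π w z₀ V)),
    C, fun e => ctwist (elTwist π e⁻¹), hP, hCG, hSM, hbd, hsym,
    fun f hf hf1 => SpectralDict.complexPosType_of_real hSM hbd hpos f hf hf1, hTμ, hT1, hTmul, hKT, hZ, ?_⟩
  intro A hA
  obtain ⟨r, hr⟩ : ∃ r : ℕ, r + 1 = thick A := ⟨thick A - 1, by have := one_le_thick A; omega⟩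
  obtain ⟨M₀, h₀⟩ : ∃ M₀ : ℕ, (M₀ + 3) + (r + 2) = 2 * S + 1 := ⟨2 * S + 1 - (r + 5), by omega⟩
  have ha : Measurable fun V : FinSpatialSite (2 * S + 1) (2 * S + 1) (2 * S + 1) × Fin 3 → H =>
      Real.sqrt (magW π w z₀ V) := measurable_sqrt_magW π w hw z₀
  have haC := abs_sqrt_magW_le π w hw0 hwC z₀
    (b₁ := 2 * S + 1) (b₂ := 2 * S + 1) (b₃ := 2 * S + 1)
  have hFm := measurable_speciesL5 π hπ A (relabel h₀ (rotAmt (2 * S + 1) (tLo A) M₀))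
  have hFb := abs_speciesL5_le π A (relabel h₀ (rotAmt (2 * S + 1) (tLo A) M₀)) (H := H)
  refine ⟨r, blockKernel Prod.fst (fun l : FinSpatialSite (2 * S + 1) (2 * S + 1) (2 * S + 1) × Fin 3 => l.1.shift l.2)
      w (fun V => Real.sqrt (magW π w z₀ V)) M₀ r (speciesL5 π A (relabel h₀ (rotAmt (2 * S + 1) (tLo A) M₀))),
    _, hr, stronglyMeasurable_uncurry_blockKernel _ _ w _ hw ha M₀ r hFm,
    norm_blockKernel_le _ _ w _ hw0 hwC haC M₀ r hFb,
    fun u v => abs_blockKernel_le_pathK _ _ w _ hw hw0 hwC ha haC (fun V => Real.sqrt_nonneg _) M₀ r hFm hFb u v,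
    fun e M hM => ?_⟩
  obtain rfl : M = M₀ := by omega
  exact secW_withEl_eq_blockChain_of π w hw hw0 hwC hcl hker hπ z₀ S A M r _
    (relabel_finRotate h₀ (rotAmt (2 * S + 1) (tLo A) M)) (fun d hd => window_relabel A h₀ hr hd) e

end SecWBlock

end Summit.QuantumFields.YangMills.Cruxes.IRcof.EquipartitionSeam.SliceKernel

end
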